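import Mathlib.Data.Fintype.BigOperators
import Mathlib.Algebra.BigOperators.Ring.Finset
import Literature.Computability.MetaComplexity.RefutationCNF
import Literature.Computability.MetaComplexity.ResolutionWidth
import HarnessLib

/-!
# The Atserias–Müller lower bound for `RREF(F,s)` (proof of [AM20, Lemma 10])

Sibling proof file of `RefutationCNF.lean` (D-0014). It discharges the named fact
`rrefCNF_lowerBound` of that file:

* `rrefCNF_lowerBound_holds` — **[Atserias–Müller 2020, Lemma 10]**: there is `n₀` such that for
  all `n ≥ n₀`, `20 ≤ w`, `13nw ≤ 2ⁿ` and every unsatisfiable CNF `F` with `n` variables, every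
  Resolution refutation of `RREF(F, 13nw)` (`rrefCNF F (13*n*w)`, in the tree's calculus
  `IsResRefutation`) has length `> 2^{2w/5}`. We obtain `n₀ = 20`.

Everything else lives in the sub-namespace `AtseriasMuller` and follows the printed proof
([AM20, §4–§5], arXiv numbering), whose architecture is:

1. **Lemma 4 (index-width lower bound for `REF`)**, a forcing / Prover–Adversary argument with
   *conditions* `p = (g,h)`: partial injective maps from line indices into the full binary-tree
   refutation of `F` (Example 3), organised in blocks `B_0, …, B_{n-k}` ↔ `B*_0, …, B*_{n-k}`
   ((H1)–(H4), (C1)–(C2)), with Claim 5 (premises come earlier), Claim 6 (restriction), Claim 7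
   (extension) and Claim 8 (no axiom of `REF` is falsified by `α(p)`), and the final "earliest
   falsified clause" argument.
2. **Lemma 10**: a random restriction `ρ` (activity bits `P[u]`, random values on the variables of
   inactive lines, `L[u,v], R[u,v] ↦ 0` towards inactive `v`), a union bound over the `≤ ℓ`
   clauses of the refutation and a concentration bound for the number of active lines; then
   `Π|ρ` refutes `REF(F,A)` with small index-width, contradicting Lemma 4.

## Contents (in the order of the file)

* Generic part: `Falsifies`, `IwDerivable` (BSW-style derivability with weakening folded in and
  an abstract side condition `ok`, here bounded index-width), the **adversary lemma**
  `IwDerivable.not_falsifies` (= the final paragraph of the proof of Lemma 4, abstractly: a family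
  of partial assignments never falsifying axioms and closed under "extend to decide a pivot, then
  shrink" falsifies no `ok`-derivable clause), and `iwDerivable_restrict_map` (a list refutation,
  renamed along `δ` and restricted by `ρ`, is an `IwDerivable` derivation of `∅`; copy of
  `resDerivable_restrict_of_isResRefutation`).
* The full-tree refutation of Example 3 with nodes `List Bool` (head = last decision, so the
  parent is the tail), heap co-numbering `heapco` (root `0`, children `2c+1, 2c+2`; the paper's
  numbering of `[s*]` read backwards) with inverse `decodeHeap`, and `D*, V*, I*, L*, R*`
  (`Dstar`, `Vstar`, `Istar`/`leafClause`, `kid`/`kids`).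
* `Frame`: the parameters of one forcing argument (active set `A`, co-rank `corank u = #{v ∈ A :
  v > u}`, blocks `blkOf`/`blk`/`blkT`), `Frame.Good` (the numerical hypotheses), block sizes.
* Conditions: `InH` (= `ℋ`), `IsCond`, `hinv` (= `h⁻¹`), `alpha` (= `α(p)`), `alpha_mono`,
  `InH.lt_of_kid` (Claim 5), `IsCond.restrict` (Claim 6), `IsCond.exists_extend` (Claim 7).
* The restriction `rho` and the merged assignment `mu = ρ ⊕ α(p)`; `nfal_A1` … `nfal_A24`,
  `nfal_rref` (Claim 8 fused with the case analysis "`C|ρ = 1` or `C|ρ ∈ REF(F,A)`" of the proof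
  of Lemma 10: no clause of `RREF(F,t)` is weakly falsified by `μ`).
* Counting in the product space `Fin N → Bool × (V → Bool)` (`card_cylinder_le`: a cylinder event
  with factors of probability `≤ 3/4` has probability `≤ (3/4)^{|M|}`; `card_tail_mul_le`: the
  exponential-moment tail bound `#{≤ m active} · 2^{N-m} ≤ (3·2^{|V|})^N`).
* `exists_fat_line` (Lemma 4 applied to `RREF(F,t)|ρ`), the events `Eset`/`BadSet` with the
  `link` to fat restricted lines, `exists_good_point` (the probabilistic existence statement as
  counting), the arithmetic of the constants, and the theorem.

## Deviations from the printed proof (none affects the statement)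

* Constants. The printed union bound "`ℓ·(3/4)^w`, which is strictly less than `1/4` for
  `ℓ ≤ 2^{2w/5}` (here we use that `w ≥ 20`)" does not hold as printed for small `w`
  (`2^8 · (3/4)^{20} ≈ 0.81`); the argument has ample slack elsewhere, and we run it with the
  index-width threshold `wI := w + ⌊w/4⌋ + 1` in Lemma 4 (so a bad clause mentions `≥ w + ⌊w/4⌋`
  randomised lines and the union bound reads `2ℓ·3^{w+⌊w/4⌋} < 4^{w+⌊w/4⌋}`, `union_arith`), with
  the last line `t` deterministically active (this is (iii)), with blocks `B_i` (`i ≥ 1`) of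
  size exactly `3·wI` (the paper's `2^{k+1} ∈ [3w, 6w)`; only `|B_i|, |B*_i| ≥ 3w` is used), and
  with the requirement `|A| ≥ 5nw + 1` (enough for the blocks to fit, `fit_arith`) in place of
  `|A| ≥ 6nw`; the Chernoff bound is replaced by the exponential-moment estimate
  `#{|A| ≤ m} ≤ 2^m (3/2)^N` (`card_tail_mul_le`, `tail_arith`). The sample space assigns to every
  line index an activity bit and a full assignment of the relevant variables (only the part on its
  own variables is read), which makes all events cylinders.
* Claim 7 as printed chooses a fresh `u'` whenever `u ∉ Dom(g)`; when `u ∈ Dom(h) ∖ Dom(g)` one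
  must take `u' := h(u)` (`exists_target` does).
* Conditions carry no sentinel `0`: `Dom(g) ⊆ A`, and `L(u) = 0` is `none`; accordingly the size
  bound is `|Dom(h)| ≤ 3|Dom(g)|` and `P` is `{α(p) : |Dom(g)| ≤ wI - 1}`.
* The tree's Resolution calculus (`Resolution.lean`) has an explicit weakening rule and allows
  tautological lines, and `rrefCNF` is a CNF over `ℕ` (variables numbered by `RefVar.code`). Both
  are absorbed by `iwDerivable_restrict_map`: the refutation is read through `RefVar.decode` (a
  left inverse of the numbering; non-injectivity off the codewords only weakens resolution steps)
  and restricted by `ρ` into an `IwDerivable` derivation over `RefVar`, on which the forcing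
  argument runs directly (so `REF(F,A)` is never materialised: its role is played by
  `RREF(F,t)|ρ`, and Claim 8 is proved for the clauses of `RREF(F,t)` under `μ = ρ ⊕ α(p)`).
* The hypothesis "clauses of `F` non-tautological" of the fact is not needed and not used.

## References

* A. Atserias, M. Müller, *Automating Resolution is NP-hard*, J. ACM 67(5) (2020), Art. 31;
  FOCS 2019; arXiv:1904.02991 (numbering used here): Example 3, §4 (Lemma 4, Claims 5–8),
  §5 (Lemma 10), Appendix (clauses (A1)–(A24)).
* E. Ben-Sasson, A. Wigderson, *Short proofs are narrow — resolution made simple*, J. ACM 48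
  (2001), §2.2 (restrictions of refutations).
-/

namespace Literature.Computability.MetaComplexity

open Complexity Finset

namespace AtseriasMuller

/-! ### Generic part: falsification, `ok`-bounded derivability, restriction, the adversary lemma -/

section Generic

variable {ν ν' : Type*}

/-- The partial assignment `α` falsifies the set-clause `C`: every literal of `C` is assigned and
made false. [Atserias–Müller 2020, §2 ("falsifies")] [folklore] -/
def Falsifies (α : ν → Option Bool) (C : Finset (Literal ν)) : Prop :=
  ∀ l ∈ C, α l.1 = some (!l.2)

/-- `α'` extends `α` as a partial assignment. [folklore] -/
def PExtends (α α' : ν → Option Bool) : Prop :=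
  ∀ x b, α x = some b → α' x = some b

/-- Falsification is antitone in the clause. [folklore] -/
theorem Falsifies.mono {α : ν → Option Bool} {C D : Finset (Literal ν)} (h : Falsifies α D)
    (hCD : C ⊆ D) : Falsifies α C :=
  fun l hl => h l (hCD hl)

/-- Falsification is monotone along extensions. [folklore] -/
theorem Falsifies.of_pExtends {α α' : ν → Option Bool} {C : Finset (Literal ν)}
    (h : Falsifies α C) (hext : PExtends α α') : Falsifies α' C :=
  fun l hl => hext _ _ (h l hl)

/-- `IwDerivable F ok E`: the set-clause `E` is derivable from the clause set `F` by resolution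
with weakening folded into both rules (as in `ResDerivable`), every derived clause satisfying the
abstract side condition `ok` (for us: bounded index-width). [Ben-Sasson–Wigderson 2001, §2.3;
Atserias–Müller 2020, §4 (index-width of a refutation)] [folklore] -/
inductive IwDerivable [DecidableEq ν] (F : Set (Finset (Literal ν)))
    (ok : Finset (Literal ν) → Prop) : Finset (Literal ν) → Prop
  /-- axiom download (with weakening) -/
  | ax {A E : Finset (Literal ν)} (hA : A ∈ F) (hAE : A ⊆ E) (hE : ok E) : IwDerivable F ok E
  /-- resolution on the pivot literal `(v, b)` (with weakening) -/
  | res {C D E : Finset (Literal ν)} {v : ν} {b : Bool} (hC : IwDerivable F ok C)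
      (hD : IwDerivable F ok D) (hvC : (v, b) ∈ C) (hvD : (v, !b) ∈ D)
      (hsub : C.erase (v, b) ∪ D.erase (v, !b) ⊆ E) (hE : ok E) : IwDerivable F ok E

/-- Derived clauses satisfy the side condition. [folklore] -/
theorem IwDerivable.ok_self [DecidableEq ν] {F : Set (Finset (Literal ν))}
    {ok : Finset (Literal ν) → Prop} {E : Finset (Literal ν)} (h : IwDerivable F ok E) : ok E := by
  cases h <;> assumption

/-- Weakening inside the side condition. [folklore] -/
theorem IwDerivable.weaken [DecidableEq ν] {F : Set (Finset (Literal ν))}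
    {ok : Finset (Literal ν) → Prop} {C E : Finset (Literal ν)} (h : IwDerivable F ok C)
    (hCE : C ⊆ E) (hE : ok E) : IwDerivable F ok E := by
  cases h with
  | ax hA hAC _ => exact IwDerivable.ax hA (hAC.trans hCE) hE
  | res hC hD hvC hvD hsub _ => exact IwDerivable.res hC hD hvC hvD (hsub.trans hCE) hE

/-- **The adversary (forcing) lemma** behind [Atserias–Müller 2020, Lemma 4]: if a family `Ps`
of partial assignments never falsifies an axiom, and every `α ∈ Ps` can be extended to decide any
literal of an `ok` clause in such a way that every `ok` clause falsified by the extension is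
already falsified inside `Ps`, then no `ok`-derivable clause is falsified by a member of `Ps`
(induction on the derivation = the "earliest falsified clause" argument of the printed proof).
[cite: AtseriasMuller2020, Lemma 4 (proof, final paragraph)] -/
theorem IwDerivable.not_falsifies [DecidableEq ν] {F : Set (Finset (Literal ν))}
    {ok : Finset (Literal ν) → Prop} {Ps : Set (ν → Option Bool)}
    (hax : ∀ α ∈ Ps, ∀ A ∈ F, ¬ Falsifies α A)
    (hext : ∀ α ∈ Ps, ∀ C, ok C → ∀ l ∈ C, ∃ α', PExtends α α' ∧ α' l.1 ≠ none ∧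
        ∀ D, ok D → Falsifies α' D → ∃ α'' ∈ Ps, Falsifies α'' D)
    {E : Finset (Literal ν)} (hE : IwDerivable F ok E) : ∀ α ∈ Ps, ¬ Falsifies α E := by
  induction hE with
  | ax hA hAE _ => exact fun α hα hF => hax α hα _ hA (hF.mono hAE)
  | @res C D E v b hC hD hvC hvD hsub _ ihC ihD =>
    intro α hα hF
    obtain ⟨α', hαα', hv, hkill⟩ := hext α hα C hC.ok_self (v, b) hvC
    obtain ⟨c, hc⟩ := Option.ne_none_iff_exists'.mp hv
    by_cases hcb : c = !b
    · -- the pivot literal `(v, b)` is false under `α'`: `α'` falsifies `C`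
      have hFC : Falsifies α' C := by
        intro l hl
        by_cases hlv : l = (v, b)
        · subst hlv; simpa [hcb] using hc
        · exact hαα' _ _ (hF l (hsub (mem_union_left _ (mem_erase.2 ⟨hlv, hl⟩))))
      obtain ⟨α'', hα'', hF''⟩ := hkill C hC.ok_self hFC
      exact ihC α'' hα'' hF''
    · -- the pivot literal `(v, !b)` is false under `α'`: `α'` falsifies `D`
      have hcb' : c = !(!b) := by cases c <;> cases b <;> simp_all
      have hFD : Falsifies α' D := by
        intro l hl
        by_cases hlv : l = (v, !b)
        · subst hlv; simpa [hcb'] using hc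
        · exact hαα' _ _ (hF l (hsub (mem_union_right _ (mem_erase.2 ⟨hlv, hl⟩))))
      obtain ⟨α'', hα'', hF''⟩ := hkill D hD.ok_self hFD
      exact ihD α'' hα'' hF''

/-- Renaming the variables of a set-clause along `δ`. [folklore] -/
def mapClause [DecidableEq ν'] (δ : ν → ν') (C : Finset (Literal ν)) : Finset (Literal ν') :=
  C.image fun l => (δ l.1, l.2)

/-- Membership in a renamed clause. [folklore] -/
theorem mem_mapClause [DecidableEq ν'] {δ : ν → ν'} {C : Finset (Literal ν)} {l' : Literal ν'} :
    l' ∈ mapClause δ C ↔ ∃ l ∈ C, (δ l.1, l.2) = l' := by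
  simp [mapClause]

/-- Renaming a literal into a renamed clause. [folklore] -/
theorem mem_mapClause_of_mem [DecidableEq ν'] {δ : ν → ν'} {C : Finset (Literal ν)} {l : Literal ν}
    (h : l ∈ C) : (δ l.1, l.2) ∈ mapClause δ C :=
  mem_mapClause.2 ⟨l, h, rfl⟩

/-- Renaming the variables of a list CNF along `δ`. [folklore] -/
def mapCNF (δ : ν → ν') (φ : CNF ν) : CNF ν' :=
  φ.map fun c => c.map fun l => (δ l.1, l.2)

/-- **Restricting (and renaming) a refutation** [Atserias–Müller 2020, §2 ("Π|α is a refutation of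
F|α of length at most s"); Ben-Sasson–Wigderson 2001, §2.2]: a list refutation `π` of `φ` over `ν`,
read through a variable renaming `δ : ν → ν'` and restricted by `ρ`, yields an `IwDerivable`
derivation of `∅` from `(δφ)|ρ`, provided every renamed line not satisfied by `ρ` restricts to an
`ok` clause. (Copy of `resDerivable_restrict_of_isResRefutation` with the width bound replaced by
`ok`; a non-injective `δ` only turns resolution steps into weakened resolution steps.)
[cite: AtseriasMuller2020, §2 (restriction of a refutation)] -/
theorem iwDerivable_restrict_map [DecidableEq ν] [DecidableEq ν'] {φ : CNF ν}
    {π : List (ResLine ν)} (hπ : IsResRefutation φ π) (δ : ν → ν') (ρ : ν' → Option Bool)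
    {ok : Finset (Literal ν') → Prop}
    (hok : ∀ l ∈ π, ¬ SatisfiedBy ρ (mapClause δ l.clause) →
      ok (restrictClause ρ (mapClause δ l.clause))) :
    IwDerivable (restrictFormula ρ (clauseSet (mapCNF δ φ))) ok ∅ := by
  obtain ⟨hder, l₀, hl₀, hl₀e⟩ := hπ
  have key : ∀ i (hi : i < π.length), ¬ SatisfiedBy ρ (mapClause δ (π[i]).clause) →
      IwDerivable (restrictFormula ρ (clauseSet (mapCNF δ φ))) ok
        (restrictClause ρ (mapClause δ (π[i]).clause)) := by
    intro i
    induction i using Nat.strong_induction_on with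
    | _ i ih =>
      intro hi hns
      have hv := hder i hi
      have hoki := hok _ (List.getElem_mem hi) hns
      unfold IsValidResLine at hv
      split at hv
      · refine IwDerivable.ax ⟨_, ?_, hns, rfl⟩ subset_rfl hoki
        obtain ⟨c, hc, hcE⟩ := List.mem_map.1 hv
        refine mem_clauseSet_iff.2 ⟨c.map fun l => (δ l.1, l.2), List.mem_map.2 ⟨c, hc, rfl⟩, ?_⟩
        rw [← hcE]
        ext l'
        simp [mapClause]
      · rename_i j₁ j₂ v _
        obtain ⟨hj₁, hj₂, hv1, hv2, hE⟩ := hv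
        rw [List.length_take] at hj₁ hj₂
        have hj₁i : j₁ < i := lt_of_lt_of_le hj₁ (min_le_left _ _)
        have hj₂i : j₂ < i := lt_of_lt_of_le hj₂ (min_le_left _ _)
        have hj₁' : j₁ < π.length := lt_of_lt_of_le hj₁ (min_le_right _ _)
        have hj₂' : j₂ < π.length := lt_of_lt_of_le hj₂ (min_le_right _ _)
        simp only [List.getElem_take] at hv1 hv2 hE
        set C₁ := (π[j₁]).clause with hC₁
        set C₂ := (π[j₂]).clause with hC₂
        set E := (π[i]).clause with hEdef
        -- literals of the renamed premises other than the pivot are in the renamed conclusion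
        have hE₁ : ∀ l ∈ mapClause δ C₁, l ≠ (δ v, true) → l ∈ mapClause δ E := by
          intro l hl hne
          obtain ⟨l₀, hl₀, rfl⟩ := mem_mapClause.1 hl
          refine mem_mapClause_of_mem ?_
          rw [hE]
          refine mem_union_left _ (mem_erase.2 ⟨?_, hl₀⟩)
          rintro rfl
          exact hne rfl
        have hE₂ : ∀ l ∈ mapClause δ C₂, l ≠ (δ v, false) → l ∈ mapClause δ E := by
          intro l hl hne
          obtain ⟨l₀, hl₀, rfl⟩ := mem_mapClause.1 hl
          refine mem_mapClause_of_mem ?_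
          rw [hE]
          refine mem_union_right _ (mem_erase.2 ⟨?_, hl₀⟩)
          rintro rfl
          exact hne rfl
        have hv1' : (δ v, true) ∈ mapClause δ C₁ := mem_mapClause_of_mem hv1
        have hv2' : (δ v, false) ∈ mapClause δ C₂ := mem_mapClause_of_mem hv2
        rcases hρv : ρ (δ v) with _ | bv
        · -- pivot unassigned: a genuine (weakened) resolution step on the restricted premises
          have hns₁ : ¬ SatisfiedBy ρ (mapClause δ C₁) := by
            rintro ⟨l, hl, hρl⟩
            refine hns ⟨l, hE₁ l hl ?_, hρl⟩
            rintro rfl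
            rw [hρv] at hρl; simp at hρl
          have hns₂ : ¬ SatisfiedBy ρ (mapClause δ C₂) := by
            rintro ⟨l, hl, hρl⟩
            refine hns ⟨l, hE₂ l hl ?_, hρl⟩
            rintro rfl
            rw [hρv] at hρl; simp at hρl
          refine IwDerivable.res (b := true) (ih j₁ hj₁i hj₁' hns₁) (ih j₂ hj₂i hj₂' hns₂)
            (mem_restrictClause.2 ⟨hv1', hρv⟩) (mem_restrictClause.2 ⟨hv2', hρv⟩) ?_ hoki
          intro l hl
          rw [mem_restrictClause]
          rcases mem_union.1 hl with h | h
          · obtain ⟨hne, hl'⟩ := mem_erase.1 h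
            obtain ⟨hlC, hρl⟩ := mem_restrictClause.1 hl'
            exact ⟨hE₁ l hlC hne, hρl⟩
          · obtain ⟨hne, hl'⟩ := mem_erase.1 h
            obtain ⟨hlC, hρl⟩ := mem_restrictClause.1 hl'
            exact ⟨hE₂ l hlC hne, hρl⟩
        · cases bv with
          | true =>
            have hns₂ : ¬ SatisfiedBy ρ (mapClause δ C₂) := by
              rintro ⟨l, hl, hρl⟩
              refine hns ⟨l, hE₂ l hl ?_, hρl⟩
              rintro rfl
              rw [hρv] at hρl; simp at hρl
            refine (ih j₂ hj₂i hj₂' hns₂).weaken ?_ hoki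
            intro l hl
            obtain ⟨hlC, hρl⟩ := mem_restrictClause.1 hl
            rw [mem_restrictClause]
            refine ⟨hE₂ l hlC ?_, hρl⟩
            rintro rfl
            rw [hρv] at hρl; simp at hρl
          | false =>
            have hns₁ : ¬ SatisfiedBy ρ (mapClause δ C₁) := by
              rintro ⟨l, hl, hρl⟩
              refine hns ⟨l, hE₁ l hl ?_, hρl⟩
              rintro rfl
              rw [hρv] at hρl; simp at hρl
            refine (ih j₁ hj₁i hj₁' hns₁).weaken ?_ hoki
            intro l hl
            obtain ⟨hlC, hρl⟩ := mem_restrictClause.1 hl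
            rw [mem_restrictClause]
            refine ⟨hE₁ l hlC ?_, hρl⟩
            rintro rfl
            rw [hρv] at hρl; simp at hρl
      · rename_i j _
        obtain ⟨hj, hsub⟩ := hv
        rw [List.length_take] at hj
        have hji : j < i := lt_of_lt_of_le hj (min_le_left _ _)
        have hj' : j < π.length := lt_of_lt_of_le hj (min_le_right _ _)
        rw [List.getElem_take] at hsub
        have hsub' : mapClause δ (π[j]).clause ⊆ mapClause δ (π[i]).clause :=
          image_subset_image hsub
        have hnsj : ¬ SatisfiedBy ρ (mapClause δ (π[j]).clause) := fun h => hns (h.mono hsub')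
        exact (ih j hji hj' hnsj).weaken (restrictClause_mono hsub') hoki
  obtain ⟨i, hi, rfl⟩ := List.mem_iff_getElem.1 hl₀
  have h := key i hi (by rw [hl₀e]; simp [mapClause, not_satisfiedBy_empty])
  rwa [hl₀e] at h

end Generic

/-! ### The full-tree refutation: nodes as `List Bool` (head = last decision), heap numbering -/

section Tree

/-- Heap co-numbering of the nodes of the full binary tree (root `[] ↦ 0`, the children of a
node with co-number `c` get `2c+1`, `2c+2`): parents come before children, so that reading the
tree top-down along increasing co-number is reading the paper's numbering of Example 3
(leaves first, root last = `s*`) backwards. [cite: AtseriasMuller2020, Example 3] -/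
def heapco : List Bool → ℕ
  | [] => 0
  | b :: a => 2 * heapco a + 1 + b.toNat

/-- `heapco` is injective. [folklore] -/
theorem heapco_injective : Function.Injective heapco := by
  intro a
  induction a with
  | nil =>
    intro b h
    cases b with
    | nil => rfl
    | cons c b' => exact absurd h (by simp [heapco]; omega)
  | cons c a ih =>
    intro b h
    cases b with
    | nil => exact absurd h (by simp [heapco])
    | cons d b' =>
      simp only [heapco] at h
      have h1 : heapco a = heapco b' := by cases c <;> cases d <;> simp at h <;> omega
      have h2 : c = d := by
        cases c <;> cases d <;> simp at h ⊢ <;> omega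
      rw [ih h1, h2]

/-- A node of level `h` has co-number `≥ 2^h - 1`. [folklore] -/
theorem two_pow_length_le_heapco_succ (a : List Bool) : 2 ^ a.length ≤ heapco a + 1 := by
  induction a with
  | nil => simp [heapco]
  | cons b a ih => simp only [List.length_cons, pow_succ, heapco]; omega

/-- A node of level `h` has co-number `< 2^(h+1) - 1`. [folklore] -/
theorem heapco_succ_lt_two_pow (a : List Bool) : heapco a + 1 < 2 ^ (a.length + 1) := by
  induction a with
  | nil => simp [heapco]
  | cons b a ih =>
    simp only [List.length_cons, pow_succ, heapco] at ih ⊢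
    cases b <;> simp <;> omega

/-- The node with a given co-number. [folklore] -/
def decodeHeap : ℕ → List Bool
  | 0 => []
  | c + 1 => decide (c % 2 = 1) :: decodeHeap (c / 2)
decreasing_by omega

/-- `decodeHeap` is a right inverse of `heapco`. [folklore] -/
theorem heapco_decodeHeap (c : ℕ) : heapco (decodeHeap c) = c := by
  induction c using Nat.strong_induction_on with
  | _ c ih =>
    cases c with
    | zero => simp [decodeHeap, heapco]
    | succ c =>
      rw [decodeHeap, heapco, ih (c / 2) (by omega)]
      rcases Nat.mod_two_eq_zero_or_one c with h | h <;> simp [h] <;> omega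

/-- Nodes with small co-number are high in the tree. [folklore] -/
theorem length_decodeHeap_le {c K : ℕ} (h : c + 1 < 2 ^ (K + 1)) : (decodeHeap c).length ≤ K := by
  have h1 := two_pow_length_le_heapco_succ (decodeHeap c)
  rw [heapco_decodeHeap] at h1
  have : 2 ^ (decodeHeap c).length < 2 ^ (K + 1) := lt_of_le_of_lt h1 h
  have := (Nat.pow_lt_pow_iff_right (by norm_num)).1 this
  omega

/-- Nodes with small co-number are high in the tree (version for an arbitrary node). [folklore] -/
theorem length_le_of_heapco_lt {a : List Bool} {K : ℕ} (h : heapco a + 1 < 2 ^ (K + 1)) :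
    a.length ≤ K := by
  have : 2 ^ a.length < 2 ^ (K + 1) := lt_of_le_of_lt (two_pow_length_le_heapco_succ a) h
  have := (Nat.pow_lt_pow_iff_right (by norm_num)).1 this
  omega

/-- The decision taken at depth `i` on the path to node `a` (`none` if `i ≥ level`): the clause
`C_a` of Example 3 contains the literal `X_{i+1}^{(b)}` iff `bitAt a i = some b`.
[cite: AtseriasMuller2020, Example 3] -/
def bitAt (a : List Bool) (i : ℕ) : Option Bool :=
  a.reverse[i]?

/-- Going to a child does not change earlier decisions. [folklore] -/
theorem bitAt_cons_of_lt {a : List Bool} {i : ℕ} (b : Bool) (hi : i < a.length) :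
    bitAt (b :: a) i = bitAt a i := by
  simp only [bitAt, List.reverse_cons]
  rw [List.getElem?_append_left (by simpa using hi)]

/-- The decision taken at a child. [folklore] -/
theorem bitAt_cons_length (a : List Bool) (b : Bool) : bitAt (b :: a) a.length = some b := by
  simp only [bitAt, List.reverse_cons]
  rw [List.getElem?_append_right (by simp)]
  simp

/-- No decision below the level of the node. [folklore] -/
theorem bitAt_eq_none {a : List Bool} {i : ℕ} (hi : a.length ≤ i) : bitAt a i = none := by
  simp only [bitAt]
  exact List.getElem?_eq_none (by simpa using hi)

/-- Every depth below the level carries a decision. [folklore] -/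
theorem bitAt_isSome {a : List Bool} {i : ℕ} (hi : i < a.length) : ∃ b, bitAt a i = some b := by
  simp only [bitAt]
  exact ⟨_, List.getElem?_eq_getElem (by simpa using hi)⟩

/-- A decision at depth `i` forces `i <` level. [folklore] -/
theorem lt_length_of_bitAt_eq_some {a : List Bool} {i : ℕ} {b : Bool} (h : bitAt a i = some b) :
    i < a.length := by
  by_contra hi
  rw [bitAt_eq_none (not_lt.1 hi)] at h
  simp at h

variable (n : ℕ)

/-- `D*` of Example 3: the literal `X_{i+1}^{(b)}` lies in the clause `C_a` of node `a`.
[cite: AtseriasMuller2020, Example 3 (D*)] -/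
def Dstar (a : List Bool) (i : ℕ) (b : Bool) : Bool :=
  decide (bitAt a i = some b)

/-- `V*` of Example 3: an internal node of level `h < n` is a cut on `X_{h+1}` (0-based pivot
index `h`), a leaf is not a resolvent (`none`). [cite: AtseriasMuller2020, Example 3 (V*)] -/
def Vstar (a : List Bool) : Option ℕ :=
  if a.length < n then some a.length else none

/-- The premises of Example 3: the left premise of the internal node `a` is its child `0a`
(containing `¬X_{h+1}`), the right premise its child `1a`; leaves have none.
[cite: AtseriasMuller2020, Example 3 (L*, R*)] -/
def kid (b : Bool) (a : List Bool) : Option (List Bool) :=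
  if a.length < n then some (b :: a) else none

/-- The children (premises) of a node, as a list. [cite: AtseriasMuller2020, Example 3] -/
def kids (a : List Bool) : List (List Bool) :=
  if a.length < n then [false :: a, true :: a] else []

/-- Membership in `kids`. [folklore] -/
theorem mem_kids_iff {a c : List Bool} : c ∈ kids n a ↔ a.length < n ∧ (c = false :: a ∨ c = true :: a) := by
  unfold kids
  split <;> simp_all

/-- `kid b a ∈ kids a`. [folklore] -/
theorem mem_kids_of_kid {a c : List Bool} {b : Bool} (h : kid n b a = some c) : c ∈ kids n a := by
  unfold kid at h
  split at h
  · cases b <;> simp_all [mem_kids_iff]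
  · simp at h

variable (X : List ℕ) (F : CNF ℕ)

/-- The assignment falsifying the clause `C_a` of a leaf `a` (variable `X[i] ↦ ¬(decision i)`),
extended by `false` off the variables of `F`. [cite: AtseriasMuller2020, Example 3] -/
def leafAssign (a : List Bool) (x : ℕ) : Bool :=
  match bitAt a (X.idxOf x) with
  | some c => !c
  | none => false

/-- `I*` of Example 3 at a leaf: the index of the first clause of `F` falsified by the leaf's
assignment (a clause `C_j` of which `C_a` is a weakening), junk `0` if there is none.
[cite: AtseriasMuller2020, Example 3 (I*)] -/
def leafClause (a : List Bool) : ℕ :=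
  ((List.range F.length).filter fun j => (F.getD j []).eval (leafAssign X a) = false).headD 0

/-- `I*` of Example 3: leaves are axioms (weakenings of the clause `leafClause`), internal
nodes are not. [cite: AtseriasMuller2020, Example 3 (I*)] -/
def Istar (a : List Bool) : Option ℕ :=
  if a.length < n then none else some (leafClause X F a)

/-- For unsatisfiable `F`, the leaf clause index is a genuine clause of `F` falsified by the
leaf assignment. [cite: AtseriasMuller2020, Example 3 ("since F is unsatisfiable, every clause
C_a that labels a leaf is a weakening of some clause C_j of F")] -/
theorem leafClause_spec {F : CNF ℕ} (hF : ¬ F.Satisfiable) (X : List ℕ) (a : List Bool) :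
    leafClause X F a < F.length ∧ (F.getD (leafClause X F a) []).eval (leafAssign X a) = false := by
  have hex : ∃ c ∈ F, c.eval (leafAssign X a) = false := by
    by_contra h
    refine hF ⟨leafAssign X a, (CNF.eval_eq_true_iff F _).2 fun c hc => ?_⟩
    cases hc' : Clause.eval (leafAssign X a) c
    · exact (h ⟨c, hc, hc'⟩).elim
    · rfl
  obtain ⟨c, hc, hcσ⟩ := hex
  obtain ⟨j, hj, rfl⟩ := List.getElem_of_mem hc
  unfold leafClause
  generalize hL : ((List.range F.length).filter
    fun j => (F.getD j []).eval (leafAssign X a) = false) = L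
  have hmem : ∀ y ∈ L, y < F.length ∧ (F.getD y []).eval (leafAssign X a) = false := by
    intro y hy
    rw [← hL] at hy
    simpa using hy
  have hjL : j ∈ L := by
    rw [← hL]
    simp [hj, hcσ]
  obtain ⟨x, xs, rfl⟩ : ∃ x xs, L = x :: xs := by
    cases L with
    | nil => simp at hjL
    | cons x xs => exact ⟨x, xs, rfl⟩
  exact hmem x (by simp)

end Tree

/-! ### The frame: active lines, co-rank, blocks -/

/-- The fixed data of the forcing argument for one restricted formula: `n` = number of variables
of `F` (= height of the full tree), `t` = number of lines of `RREF(F,t)`, the activity predicate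
(the random set `A` of [Atserias–Müller 2020, proof of Lemma 10]), the number `K` of top levels
forming block 0 (the paper's `k`), the common size `wB` of the other blocks (the paper's `3w`;
we use blocks of size exactly `3w` rather than `2^{k+1}`), and `X`, `F` for clause (A19).
[cite: AtseriasMuller2020, Lemma 4 (proof: k, the blocks B_i)] -/
structure Frame where
  /-- number of variables of `F` = height of the full binary tree -/
  n : ℕ
  /-- number of lines -/
  t : ℕ
  /-- activity of line indices (meaningful below `t`) -/
  act : ℕ → Bool
  /-- block 0 consists of the top `K+1` levels / the last `2^(K+1)-1` active lines -/
  K : ℕ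
  /-- size of the blocks `B_1, …, B_{n-K}` of active lines -/
  wB : ℕ
  /-- the variables of `F`, in order -/
  X : List ℕ
  /-- the CNF `F` -/
  F : CNF ℕ

namespace Frame

variable (Φ : Frame)

/-- The set `A` of active line indices. [cite: AtseriasMuller2020, Lemma 10 (proof: the set A)] -/
def A : Finset ℕ := (range Φ.t).filter fun u => Φ.act u = true

/-- The co-rank of a line index: the number of active lines above it (the last active line has
co-rank `0`; on `A` this is `s - (rank in A)`). [folklore] -/
def corank (u : ℕ) : ℕ := (Φ.A.filter fun v => u < v).card

/-- `c₀ = 2^(K+1) - 1`, the number of nodes in the top `K+1` levels = `|B_0|`.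
[cite: AtseriasMuller2020, Lemma 4 (proof: |B_0| = 2^{k+1}-1)] -/
def c0 : ℕ := 2 ^ (Φ.K + 1) - 1

/-- The number `n - K` of blocks below block 0. [cite: AtseriasMuller2020, Lemma 4 (proof)] -/
def nB : ℕ := Φ.n - Φ.K

/-- The block of a co-rank: `0` for the `c₀` smallest co-ranks (largest lines), then blocks of
`wB` consecutive co-ranks, the last block `nB` taking the rest.
[cite: AtseriasMuller2020, Lemma 4 (proof: the intervals B_0, …, B_{n-k})] -/
def blkOf (c : ℕ) : ℕ := if c < Φ.c0 then 0 else min Φ.nB (1 + (c - Φ.c0) / Φ.wB)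

/-- The block `B_i ∋ u` of a line index. [cite: AtseriasMuller2020, Lemma 4 (proof)] -/
def blk (u : ℕ) : ℕ := Φ.blkOf (Φ.corank u)

/-- The block `B*_i ∋ a` of a tree node: `0` for the top `K+1` levels, `i` for level `K+i`.
[cite: AtseriasMuller2020, Lemma 4 (proof: the intervals B*_0, …, B*_{n-k})] -/
def blkT (a : List Bool) : ℕ := a.length - Φ.K

/-- The standing hypotheses on the frame: `K < n`, `0 < wB ≤ 2^(K+1)` (so that `|B*_i| ≥ wB`),
the blocks fit into `A`, and `F` is unsatisfiable with variables listed by `X` (`|X| = n`).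
[cite: AtseriasMuller2020, Lemma 4 (hypotheses 2^n ≥ s ≥ 6nw)] -/
structure Good : Prop where
  /-- block 0 does not exhaust the tree -/
  K_lt : Φ.K < Φ.n
  /-- blocks are nonempty -/
  wB_pos : 0 < Φ.wB
  /-- the tree blocks `B*_i`, `i ≥ 1`, have at least `wB` nodes -/
  wB_le : Φ.wB ≤ 2 ^ (Φ.K + 1)
  /-- the line blocks fit: `s ≥ c₀ + wB · nB` -/
  fit : Φ.c0 + Φ.wB * Φ.nB ≤ Φ.A.card
  /-- `F` is unsatisfiable -/
  unsat : ¬ Φ.F.Satisfiable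
  /-- `X` lists the variables of `F` -/
  mem_X : ∀ c ∈ Φ.F, ∀ l ∈ c, l.1 ∈ Φ.X
  /-- `F` has `n` variables -/
  length_X : Φ.X.length = Φ.n

/-! #### Co-rank -/

/-- Membership in the active set. [folklore] -/
theorem mem_A {u : ℕ} : u ∈ Φ.A ↔ u < Φ.t ∧ Φ.act u = true := by
  simp [A]

/-- Co-rank is strictly antitone on `A`. [folklore] -/
theorem corank_lt_corank {u v : ℕ} (hv : v ∈ Φ.A) (huv : u < v) :
    Φ.corank v < Φ.corank u := by
  unfold corank
  apply card_lt_card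
  refine ⟨fun x hx => ?_, fun hsub => ?_⟩
  · rw [mem_filter] at hx ⊢
    exact ⟨hx.1, huv.trans hx.2⟩
  · have : v ∈ Φ.A.filter fun x => u < x := mem_filter.2 ⟨hv, huv⟩
    have := hsub this
    rw [mem_filter] at this
    exact lt_irrefl _ this.2

/-- Co-ranks are `< |A|`. [folklore] -/
theorem corank_lt_card {u : ℕ} (hu : u ∈ Φ.A) : Φ.corank u < Φ.A.card := by
  unfold corank
  apply card_lt_card
  refine ⟨filter_subset _ _, fun hsub => ?_⟩
  have := mem_filter.1 (hsub hu)
  exact lt_irrefl _ this.2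

/-- Order of active lines = reverse order of co-ranks. [folklore] -/
theorem lt_iff_corank_lt {u v : ℕ} (hu : u ∈ Φ.A) (hv : v ∈ Φ.A) :
    u < v ↔ Φ.corank v < Φ.corank u := by
  constructor
  · exact Φ.corank_lt_corank hv
  · intro h
    rcases lt_trichotomy u v with huv | rfl | hvu
    · exact huv
    · exact absurd h (lt_irrefl _)
    · exact absurd (Φ.corank_lt_corank hu hvu) (not_lt.2 h.le)

/-- Co-rank is injective on `A`. [folklore] -/
theorem corank_injOn : Set.InjOn Φ.corank Φ.A := by
  intro u hu v hv h
  rcases lt_trichotomy u v with huv | rfl | hvu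
  · exact absurd h (Φ.corank_lt_corank hv huv).ne'
  · rfl
  · exact absurd h (Φ.corank_lt_corank hu hvu).ne

/-- Every value `< |A|` is a co-rank. [folklore] -/
theorem exists_corank_eq {c : ℕ} (hc : c < Φ.A.card) : ∃ u ∈ Φ.A, Φ.corank u = c := by
  have h := surjOn_of_injOn_of_card_le (s := Φ.A) (t := range Φ.A.card) Φ.corank
    (fun u hu => by simpa using Φ.corank_lt_card hu) Φ.corank_injOn (by simp)
  obtain ⟨u, hu, huc⟩ := h (by simpa using hc)
  exact ⟨u, hu, huc⟩

/-- The last line, when active, has co-rank `0`. [folklore] -/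
theorem corank_last (ht : 0 < Φ.t) : Φ.corank (Φ.t - 1) = 0 := by
  unfold corank
  rw [card_eq_zero, filter_eq_empty_iff]
  intro v hv
  have := (Φ.mem_A.1 hv).1
  omega

/-! #### Blocks -/

/-- `blkOf` is monotone. [folklore] -/
theorem blkOf_mono : Monotone Φ.blkOf := by
  intro c d hcd
  unfold blkOf
  split_ifs with h1 h2
  · exact le_rfl
  · exact Nat.zero_le _
  · omega
  · refine min_le_min le_rfl (Nat.add_le_add_left (Nat.div_le_div_right (by omega)) _)

/-- `blkOf c ≤ nB`. [folklore] -/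
theorem blkOf_le (c : ℕ) : Φ.blkOf c ≤ Φ.nB := by
  unfold blkOf
  split_ifs
  · exact Nat.zero_le _
  · exact min_le_left _ _

/-- Block 0 is exactly the co-ranks `< c₀` (when there is at least one further block).
[folklore] -/
theorem blkOf_eq_zero_iff {c : ℕ} (hnB : 0 < Φ.nB) : Φ.blkOf c = 0 ↔ c < Φ.c0 := by
  unfold blkOf
  split_ifs with h
  · simp [h]
  · simp only [h, iff_false]
    intro h0
    have : 1 ≤ min Φ.nB (1 + (c - Φ.c0) / Φ.wB) := le_min hnB (Nat.le_add_right 1 _)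
    omega

/-- The co-ranks of block `i ≥ 1`. [folklore] -/
theorem blkOf_eq_of_mem_Ico {c j : ℕ} (hj : j + 1 ≤ Φ.nB)
    (hc : Φ.c0 + Φ.wB * j ≤ c) (hc' : c < Φ.c0 + Φ.wB * j + Φ.wB) : Φ.blkOf c = j + 1 := by
  unfold blkOf
  have hcc : ¬ c < Φ.c0 := by omega
  rw [if_neg hcc]
  have hdiv : (c - Φ.c0) / Φ.wB = j := by
    apply Nat.div_eq_of_lt_le
    · rw [mul_comm]; omega
    · rw [Nat.succ_mul, mul_comm]; omega
  rw [hdiv, Nat.min_def]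
  split_ifs <;> omega

/-- The blocks `B_i`, `1 ≤ i ≤ nB`, contain at least `wB` active lines.
[cite: AtseriasMuller2020, Lemma 4 (proof: |B_i| ≥ 3w)] -/
theorem wB_le_card_blk (hG : Φ.Good) {j : ℕ} (hj : j + 1 ≤ Φ.nB) :
    Φ.wB ≤ (Φ.A.filter fun u => Φ.blk u = j + 1).card := by
  have hsub : Ico (Φ.c0 + Φ.wB * j) (Φ.c0 + Φ.wB * j + Φ.wB) ⊆
      (Φ.A.filter fun u => Φ.blk u = j + 1).image Φ.corank := by
    intro c hc
    rw [mem_Ico] at hc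
    have hcs : c < Φ.A.card := by
      have h3 : Φ.wB * (j + 1) ≤ Φ.wB * Φ.nB := Nat.mul_le_mul_left _ hj
      have := hG.fit
      rw [Nat.mul_succ] at h3
      omega
    obtain ⟨u, hu, huc⟩ := Φ.exists_corank_eq hcs
    refine mem_image.2 ⟨u, mem_filter.2 ⟨hu, ?_⟩, huc⟩
    unfold blk
    rw [huc]
    exact Φ.blkOf_eq_of_mem_Ico hj hc.1 hc.2
  have h1 := card_le_card hsub
  rw [Nat.card_Ico] at h1
  have h2 : Φ.c0 + Φ.wB * j + Φ.wB - (Φ.c0 + Φ.wB * j) = Φ.wB := by omega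
  rw [h2] at h1
  exact h1.trans card_image_le

/-- Lines in a higher block come earlier. [folklore] -/
theorem corank_lt_of_blk_lt {u v : ℕ} (h : Φ.blk v < Φ.blk u) : Φ.corank v < Φ.corank u := by
  by_contra hle
  exact absurd (Φ.blkOf_mono (not_lt.1 hle)) (not_le.2 h)

end Frame

/-- The nodes of level `ℓ` of the full binary tree. [folklore] -/
def levelNodes (ℓ : ℕ) : Finset (List Bool) :=
  (univ : Finset (Fin ℓ → Bool)).image List.ofFn

/-- There are `2^ℓ` nodes of level `ℓ`. [folklore] -/
theorem card_levelNodes (ℓ : ℕ) : (levelNodes ℓ).card = 2 ^ ℓ := by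
  unfold levelNodes
  rw [card_image_of_injective _ List.ofFn_injective]
  simp

/-- Membership in `levelNodes`. [folklore] -/
theorem mem_levelNodes_iff {ℓ : ℕ} {a : List Bool} : a ∈ levelNodes ℓ ↔ a.length = ℓ := by
  unfold levelNodes
  simp only [mem_image, mem_univ, true_and]
  constructor
  · rintro ⟨f, rfl⟩; simp
  · rintro rfl; exact ⟨fun i => a[i], List.ofFn_getElem⟩

/-! ### Conditions -/

section Conditions

variable (Φ : Frame)

/-- A partial map from line indices to tree nodes (the `g`, `h` of a condition). [folklore] -/
abbrev PMap : Type := ℕ → Option (List Bool)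

/-- The domain of a partial map (inside `A`). [cite: AtseriasMuller2020, Lemma 4 (Dom(g))] -/
def dom (g : PMap) : Finset ℕ := Φ.A.filter fun u => (g u).isSome

/-- The image of a partial map (on `A`). [cite: AtseriasMuller2020, Lemma 4 (Img(g))] -/
def img (g : PMap) : Finset (List Bool) := Φ.A.biUnion fun u => (g u).toFinset

/-- The boundary `∂I`: the premises (children) of the nodes in `I`.
[cite: AtseriasMuller2020, Lemma 4 (proof: ∂I)] -/
def bd (S : Finset (List Bool)) : Finset (List Bool) := S.biUnion fun a => (kids Φ.n a).toFinset

variable {Φ}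

/-- Membership in `dom`. [folklore] -/
theorem mem_dom {g : PMap} {u : ℕ} : u ∈ dom Φ g ↔ u ∈ Φ.A ∧ ∃ a, g u = some a := by
  simp [dom, Option.isSome_iff_exists]

/-- Membership in `img`. [folklore] -/
theorem mem_img {g : PMap} {a : List Bool} : a ∈ img Φ g ↔ ∃ u ∈ Φ.A, g u = some a := by
  simp [img]

/-- Membership in `bd`. [folklore] -/
theorem mem_bd {S : Finset (List Bool)} {c : List Bool} : c ∈ bd Φ S ↔ ∃ a ∈ S, c ∈ kids Φ.n a := by
  simp [bd]

variable (Φ)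

/-- The class `ℋ` of [Atserias–Müller 2020, Lemma 4]: partial injective maps from active lines to
tree nodes preserving blocks (H4) and rigid on block 0 (H3: a line of co-rank `c < c₀` may only
go to the node of heap co-number `c`). [cite: AtseriasMuller2020, Lemma 4 (conditions (H1)–(H4))] -/
structure InH (g : PMap) : Prop where
  /-- the domain consists of active lines -/
  mem : ∀ u a, g u = some a → u ∈ Φ.A
  /-- values are nodes of the tree of height `n` -/
  len : ∀ u a, g u = some a → a.length ≤ Φ.n
  /-- (H4) blocks are preserved -/
  blk : ∀ u a, g u = some a → Φ.blkT a = Φ.blk u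
  /-- (H3) block 0 is mapped by the fixed bijection `t` -/
  heap : ∀ u a, g u = some a → Φ.corank u < Φ.c0 → heapco a = Φ.corank u
  /-- (H1) injectivity -/
  inj : ∀ u v a, g u = some a → g v = some a → u = v

/-- A condition `p = (g,h)`: `g ⊆ h` in `ℋ` with `Img(h) = Img(g) ∪ ∂Img(g)`.
[cite: AtseriasMuller2020, Lemma 4 (conditions (C1)–(C2))] -/
structure IsCond (g h : PMap) : Prop where
  /-- `g ∈ ℋ` -/
  hg : InH Φ g
  /-- `h ∈ ℋ` -/
  hh : InH Φ h
  /-- (C1) `g ⊆ h` -/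
  sub : ∀ u a, g u = some a → h u = some a
  /-- (C2), `⊆`: `Img(h) ⊆ Img(g) ∪ ∂Img(g)` -/
  imgh : ∀ u a, h u = some a → a ∈ img Φ g ∨ a ∈ bd Φ (img Φ g)
  /-- (C2), `⊇`: `∂Img(g) ⊆ Img(h)` -/
  bdh : ∀ c ∈ bd Φ (img Φ g), ∃ u, h u = some c

/-- `h⁻¹(c)` for an injective partial map `h` (`none` off the image).
[cite: AtseriasMuller2020, Lemma 4 (h^{-1})] -/
def hinv (h : PMap) (c : List Bool) : Option ℕ :=
  if hne : (Φ.A.filter fun v => h v = some c).Nonempty then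
    some ((Φ.A.filter fun v => h v = some c).min' hne)
  else none

variable {Φ}

/-- `hinv` inverts `h ∈ ℋ`. [folklore] -/
theorem hinv_eq_some_iff {h : PMap} (hH : InH Φ h) {c : List Bool} {v : ℕ} :
    hinv Φ h c = some v ↔ h v = some c := by
  unfold hinv
  split_ifs with hne
  · constructor
    · intro hv
      have hm := min'_mem _ hne
      rw [Option.some_inj.1 hv] at hm
      exact (mem_filter.1 hm).2
    · intro hv
      have hvm : v ∈ Φ.A.filter fun v => h v = some c := mem_filter.2 ⟨hH.mem _ _ hv, hv⟩
      have hm := min'_mem _ hne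
      have := (mem_filter.1 hm).2
      rw [hH.inj _ _ _ this hv]
  · simp only [false_iff]
    intro hv
    exact hne ⟨v, mem_filter.2 ⟨hH.mem _ _ hv, hv⟩⟩

/-- `hinv` is `none` off the image. [folklore] -/
theorem hinv_eq_none_iff {h : PMap} (hH : InH Φ h) {c : List Bool} :
    hinv Φ h c = none ↔ ∀ v, h v ≠ some c := by
  constructor
  · intro hn v hv
    have := (hinv_eq_some_iff hH).2 hv
    rw [hn] at this
    simp at this
  · intro hv
    cases hc : hinv Φ h c with
    | none => rfl
    | some v => exact absurd ((hinv_eq_some_iff hH).1 hc) (hv v)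

/-- The line index mentioned by a variable ("owner"). Every variable mentions exactly one index.
[cite: AtseriasMuller2020, §4 ("The index u is mentioned in the variables D[u,i,b], V[u,i],
I[u,j], L[u,v], R[u,v]")] -/
def owner : RefVar → ℕ
  | .D u _ _ => u
  | .V u _ => u
  | .I u _ => u
  | .L u _ => u
  | .R u _ => u
  | .P u => u

variable (Φ)

/-- The partial assignment `α(p)` of a condition `p = (g,h)`: on the variables mentioning a line
`u ∈ Dom(g)` it describes the node `g(u)` of the full-tree refutation, with premise pointers
pulled back through `h⁻¹` (`P[u]` gets `true`; the value is irrelevant as `P` is decided by the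
restriction). [cite: AtseriasMuller2020, Lemma 4 (definition of α(p))] -/
def alpha (g h : PMap) : RefVar → Option Bool
  | .D u i b => (g u).map fun a => Dstar a i b
  | .V u i => (g u).map fun a => decide (Vstar Φ.n a = i)
  | .I u j => (g u).map fun a => decide (Istar Φ.n Φ.X Φ.F a = j)
  | .L u v => (g u).map fun a => decide ((kid Φ.n false a).bind (hinv Φ h) = v)
  | .R u v => (g u).map fun a => decide ((kid Φ.n true a).bind (hinv Φ h) = v)
  | .P u => (g u).map fun _ => true

variable {Φ}

/-- `α(p)` is defined exactly on the variables mentioning `Dom(g)`.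
[cite: AtseriasMuller2020, Lemma 4 ("α(p) is defined precisely on the variables of G that
mention some u ∈ Dom(g)")] -/
theorem alpha_eq_none_iff {g h : PMap} {x : RefVar} : alpha Φ g h x = none ↔ g (owner x) = none := by
  cases x <;> simp [alpha, owner]

/-- For conditions, `h⁻¹` of a premise of `g(u)` is stable under extension of the condition.
[folklore] -/
theorem hinv_kid_eq {g h g₂ h₂ : PMap} (hc : IsCond Φ g h) (hc₂ : IsCond Φ g₂ h₂)
    (hhh : ∀ u a, h u = some a → h₂ u = some a) {u : ℕ} {a : List Bool}
    (hu : g u = some a) (b : Bool) :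
    (kid Φ.n b a).bind (hinv Φ h) = (kid Φ.n b a).bind (hinv Φ h₂) := by
  cases hk : kid Φ.n b a with
  | none => rfl
  | some c =>
    simp only [Option.bind_some]
    have hcb : c ∈ bd Φ (img Φ g) :=
      mem_bd.2 ⟨a, mem_img.2 ⟨u, hc.hg.mem _ _ hu, hu⟩, mem_kids_of_kid _ hk⟩
    obtain ⟨v, hv⟩ := hc.bdh c hcb
    rw [(hinv_eq_some_iff hc.hh).2 hv, (hinv_eq_some_iff hc₂.hh).2 (hhh _ _ hv)]

/-- `α` is monotone along extension of conditions (`g ⊆ g₂`, `h ⊆ h₂`).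
[cite: AtseriasMuller2020, Lemma 4 ("if a condition p' extends p, then α(p) ⊆ α(p')")] -/
theorem alpha_mono {g h g₂ h₂ : PMap} (hc : IsCond Φ g h) (hc₂ : IsCond Φ g₂ h₂)
    (hgg : ∀ u a, g u = some a → g₂ u = some a) (hhh : ∀ u a, h u = some a → h₂ u = some a) :
    PExtends (alpha Φ g h) (alpha Φ g₂ h₂) := by
  intro x b hx
  cases x with
  | D u i c =>
    simp only [alpha] at hx ⊢
    cases hu : g u with
    | none => simp [hu] at hx
    | some a => rw [hu] at hx; rw [hgg _ _ hu]; exact hx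
  | V u i =>
    simp only [alpha] at hx ⊢
    cases hu : g u with
    | none => simp [hu] at hx
    | some a => rw [hu] at hx; rw [hgg _ _ hu]; exact hx
  | I u j =>
    simp only [alpha] at hx ⊢
    cases hu : g u with
    | none => simp [hu] at hx
    | some a => rw [hu] at hx; rw [hgg _ _ hu]; exact hx
  | L u v =>
    simp only [alpha] at hx ⊢
    cases hu : g u with
    | none => simp [hu] at hx
    | some a =>
      rw [hu] at hx; rw [hgg _ _ hu]
      simp only [Option.map_some] at hx ⊢
      rw [← hinv_kid_eq hc hc₂ hhh hu]
      exact hx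
  | R u v =>
    simp only [alpha] at hx ⊢
    cases hu : g u with
    | none => simp [hu] at hx
    | some a =>
      rw [hu] at hx; rw [hgg _ _ hu]
      simp only [Option.map_some] at hx ⊢
      rw [← hinv_kid_eq hc hc₂ hhh hu]
      exact hx
  | P u =>
    simp only [alpha] at hx ⊢
    cases hu : g u with
    | none => simp [hu] at hx
    | some a => rw [hu] at hx; rw [hgg _ _ hu]; exact hx

/-- **Claim 5** of [Atserias–Müller 2020]: along `h ∈ ℋ`, premises are earlier lines —
if `h(v) = a` and `h(u)` is a premise (child) of `a`, then `u < v`.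
[cite: AtseriasMuller2020, Claim 5] -/
theorem InH.lt_of_kid {h : PMap} (hH : InH Φ h) (hG : Φ.Good) {u v : ℕ} {a c : List Bool}
    (hv : h v = some a) (hc : c ∈ kids Φ.n a) (hu : h u = some c) : u < v := by
  have huA := hH.mem _ _ hu
  have hvA := hH.mem _ _ hv
  have hnB : 0 < Φ.nB := by have := hG.K_lt; unfold Frame.nB; omega
  obtain ⟨halt, hceq⟩ := (mem_kids_iff _).1 hc
  have hclen : c.length = a.length + 1 := by rcases hceq with rfl | rfl <;> simp
  have hcheap : heapco a < heapco c := by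
    rcases hceq with rfl | rfl <;> simp [heapco] <;> omega
  rw [Φ.lt_iff_corank_lt huA hvA]
  have hbu := hH.blk _ _ hu
  have hbv := hH.blk _ _ hv
  unfold Frame.blkT at hbu hbv
  by_cases hK : a.length < Φ.K
  · -- both in block 0: compare heap co-numbers
    have hbu0 : Φ.blk u = 0 := by rw [← hbu]; omega
    have hbv0 : Φ.blk v = 0 := by rw [← hbv]; omega
    have hcu : Φ.corank u < Φ.c0 := (Φ.blkOf_eq_zero_iff hnB).1 hbu0
    have hcv : Φ.corank v < Φ.c0 := (Φ.blkOf_eq_zero_iff hnB).1 hbv0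
    rw [← hH.heap _ _ hu hcu, ← hH.heap _ _ hv hcv]
    exact hcheap
  · -- `u` is one block further down
    apply Φ.corank_lt_of_blk_lt
    rw [← hbu, ← hbv]
    omega

/-- `|Img(g)| ≤ |Dom(g)|`. [folklore] -/
theorem card_img_le (g : PMap) : (img Φ g).card ≤ (dom Φ g).card := by
  unfold img
  refine card_biUnion_le.trans ?_
  rw [dom, card_filter]
  refine sum_le_sum fun u _ => ?_
  cases g u <;> simp

/-- `|∂S| ≤ 2|S|`. [folklore] -/
theorem card_bd_le (S : Finset (List Bool)) : (bd Φ S).card ≤ 2 * S.card := by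
  unfold bd
  refine card_biUnion_le.trans ?_
  rw [mul_comm, card_eq_sum_ones, sum_mul]
  refine sum_le_sum fun a _ => ?_
  refine (List.toFinset_card_le _).trans ?_
  unfold kids
  split_ifs <;> simp

/-- For an injective partial map, `|Dom(h)| ≤ |Img(h)|`. [folklore] -/
theorem card_dom_le_card_img {h : PMap} (hH : InH Φ h) : (dom Φ h).card ≤ (img Φ h).card := by
  refine card_le_card_of_injOn (fun u => (h u).getD []) (fun u hu => ?_) ?_
  · obtain ⟨huA, a, ha⟩ := mem_dom.1 hu
    exact mem_img.2 ⟨u, huA, by simp [ha]⟩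
  · intro u hu v hv huv
    obtain ⟨-, a, ha⟩ := mem_dom.1 hu
    obtain ⟨-, b, hb⟩ := mem_dom.1 hv
    simp only [ha, hb, Option.getD_some] at huv
    subst huv
    exact hH.inj _ _ _ ha hb

/-- The size bound `|Dom(h)| ≤ 3|Dom(g)|` for conditions (the paper's `|Dom(h)| ≤ 3|Dom(g)| - 2`,
which counts the extra element `0`). [cite: AtseriasMuller2020, Lemma 4 (eq. (sizeh))] -/
theorem IsCond.card_dom_h_le {g h : PMap} (hc : IsCond Φ g h) :
    (dom Φ h).card ≤ 3 * (dom Φ g).card := by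
  have h1 : img Φ h ⊆ img Φ g ∪ bd Φ (img Φ g) := by
    intro a ha
    obtain ⟨u, -, hu⟩ := mem_img.1 ha
    exact mem_union.2 (hc.imgh _ _ hu)
  calc (dom Φ h).card ≤ (img Φ h).card := card_dom_le_card_img hc.hh
    _ ≤ (img Φ g ∪ bd Φ (img Φ g)).card := card_le_card h1
    _ ≤ (img Φ g).card + (bd Φ (img Φ g)).card := card_union_le _ _
    _ ≤ (dom Φ g).card + 2 * (dom Φ g).card :=
        add_le_add (card_img_le g) ((card_bd_le _).trans (Nat.mul_le_mul_left _ (card_img_le g)))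
    _ = 3 * (dom Φ g).card := by ring

/-! #### Sub-maps, one-point extensions -/

/-- `ℋ` is closed under passing to sub-maps. [cite: AtseriasMuller2020, Claim 6 ("(H1)-(H4) are
preserved by restrictions")] -/
theorem InH.of_sub {g g' : PMap} (hH : InH Φ g) (hsub : ∀ u a, g' u = some a → g u = some a) :
    InH Φ g' where
  mem _ _ hu := hH.mem _ _ (hsub _ _ hu)
  len _ _ hu := hH.len _ _ (hsub _ _ hu)
  blk _ _ hu := hH.blk _ _ (hsub _ _ hu)
  heap _ _ hu := hH.heap _ _ (hsub _ _ hu)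
  inj _ _ _ hu hv := hH.inj _ _ _ (hsub _ _ hu) (hsub _ _ hv)

/-- `img` is monotone. [folklore] -/
theorem img_mono {g g₂ : PMap} (hgg : ∀ u a, g u = some a → g₂ u = some a) : img Φ g ⊆ img Φ g₂ := by
  intro a ha
  obtain ⟨u, hu, hua⟩ := mem_img.1 ha
  exact mem_img.2 ⟨u, hu, hgg _ _ hua⟩

/-- `bd` is monotone. [folklore] -/
theorem bd_mono {S T : Finset (List Bool)} (h : S ⊆ T) : bd Φ S ⊆ bd Φ T := by
  intro c hc
  obtain ⟨a, ha, hc⟩ := mem_bd.1 hc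
  exact mem_bd.2 ⟨a, h ha, hc⟩

/-- The one-point extension `g ∪ {(u,a)}` (overwriting). [folklore] -/
def ext1 (g : PMap) (u : ℕ) (a : List Bool) : PMap := fun v => if v = u then some a else g v

/-- The new value of a one-point extension. [folklore] -/
theorem ext1_self (g : PMap) (u : ℕ) (a : List Bool) : ext1 g u a u = some a := by simp [ext1]

/-- A one-point extension is unchanged elsewhere. [folklore] -/
theorem ext1_of_ne (g : PMap) {u v : ℕ} (a : List Bool) (h : v ≠ u) : ext1 g u a v = g v := by
  simp [ext1, h]

/-- The graph of a one-point extension of a map undefined at the new point. [folklore] -/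
theorem ext1_eq_some_iff {g : PMap} {u v : ℕ} {a b : List Bool} (hgu : g u = none) :
    ext1 g u a v = some b ↔ g v = some b ∨ (v = u ∧ b = a) := by
  unfold ext1
  split_ifs with h
  · subst h; simp [hgu, eq_comm]
  · simp [h]

/-- A map is contained in its one-point extensions at fresh points. [folklore] -/
theorem sub_ext1 {g : PMap} {u : ℕ} (a : List Bool) (hgu : g u = none) :
    ∀ v b, g v = some b → ext1 g u a v = some b :=
  fun _ _ hv => (ext1_eq_some_iff hgu).2 (Or.inl hv)

/-- The domain of a one-point extension. [folklore] -/
theorem card_dom_ext1_le (g : PMap) (u : ℕ) (a : List Bool) :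
    (dom Φ (ext1 g u a)).card ≤ (dom Φ g).card + 1 := by
  have : dom Φ (ext1 g u a) ⊆ insert u (dom Φ g) := by
    intro v hv
    obtain ⟨hvA, b, hb⟩ := mem_dom.1 hv
    by_cases hvu : v = u
    · subst hvu; exact mem_insert_self _ _
    · rw [ext1_of_ne _ _ hvu] at hb
      exact mem_insert_of_mem (mem_dom.2 ⟨hvA, b, hb⟩)
  exact (card_le_card this).trans (card_insert_le _ _)

/-- Extending a map of `ℋ` by a fresh, admissible value stays in `ℋ`. [folklore] -/
theorem InH.ext1 {h : PMap} (hH : InH Φ h) {u : ℕ} {a : List Bool} (hu : u ∈ Φ.A)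
    (hhu : h u = none) (hlen : a.length ≤ Φ.n) (hblk : Φ.blkT a = Φ.blk u)
    (hheap : Φ.corank u < Φ.c0 → heapco a = Φ.corank u) (hfresh : ∀ v, h v ≠ some a) :
    InH Φ (ext1 h u a) where
  mem v b hv := by
    rcases (ext1_eq_some_iff hhu).1 hv with hv | ⟨rfl, rfl⟩
    · exact hH.mem _ _ hv
    · exact hu
  len v b hv := by
    rcases (ext1_eq_some_iff hhu).1 hv with hv | ⟨rfl, rfl⟩
    · exact hH.len _ _ hv
    · exact hlen
  blk v b hv := by
    rcases (ext1_eq_some_iff hhu).1 hv with hv | ⟨rfl, rfl⟩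
    · exact hH.blk _ _ hv
    · exact hblk
  heap v b hv := by
    rcases (ext1_eq_some_iff hhu).1 hv with hv | ⟨rfl, rfl⟩
    · exact hH.heap _ _ hv
    · exact hheap
  inj v w b hv hw := by
    rcases (ext1_eq_some_iff hhu).1 hv with hv' | ⟨rfl, rfl⟩
    · rcases (ext1_eq_some_iff hhu).1 hw with hw' | ⟨rfl, rfl⟩
      · exact hH.inj _ _ _ hv' hw'
      · exact absurd hv' (hfresh _)
    · rcases (ext1_eq_some_iff hhu).1 hw with hw' | ⟨rfl, -⟩
      · exact absurd hw' (hfresh _)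
      · rfl

/-! #### Claim 6: restriction of a condition -/

/-- `g` restricted to `I`. [cite: AtseriasMuller2020, Claim 6 (p|I)] -/
def restrictG (I : Finset ℕ) (g : PMap) : PMap := fun u => if u ∈ I then g u else none

variable (Φ) in
/-- The values kept by the restricted `h`: `Img(g|I) ∪ ∂Img(g|I)`. [cite: AtseriasMuller2020,
Claim 6] -/
def keepSet (I : Finset ℕ) (g : PMap) : Finset (List Bool) :=
  img Φ (restrictG I g) ∪ bd Φ (img Φ (restrictG I g))

variable (Φ) in
/-- `h` restricted to the preimage of `keepSet`. [cite: AtseriasMuller2020, Claim 6 (p|I)] -/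
def restrictH (I : Finset ℕ) (g h : PMap) : PMap := fun u =>
  (h u).bind fun c => if c ∈ keepSet Φ I g then some c else none

/-- The graph of `g|I`. [folklore] -/
theorem restrictG_eq_some_iff {I : Finset ℕ} {g : PMap} {u : ℕ} {a : List Bool} :
    restrictG I g u = some a ↔ u ∈ I ∧ g u = some a := by
  unfold restrictG; split_ifs with h <;> simp [h]

/-- The graph of the restricted `h`. [folklore] -/
theorem restrictH_eq_some_iff {I : Finset ℕ} {g h : PMap} {u : ℕ} {a : List Bool} :
    restrictH Φ I g h u = some a ↔ h u = some a ∧ a ∈ keepSet Φ I g := by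
  unfold restrictH
  cases hu : h u with
  | none => simp
  | some c =>
    simp only [Option.bind_some]
    split_ifs with hc
    · constructor
      · intro h1; cases h1; exact ⟨rfl, hc⟩
      · rintro ⟨h1, -⟩; cases h1; rfl
    · simp only [false_iff, not_and]
      intro h1; cases h1; exact hc

/-- **Claim 6** of [Atserias–Müller 2020]: the restriction of a condition is a condition (and,
by `alpha_mono`, its `α` is a sub-assignment). [cite: AtseriasMuller2020, Claim 6] -/
theorem IsCond.restrict {g h : PMap} (hc : IsCond Φ g h) (I : Finset ℕ) :
    IsCond Φ (restrictG I g) (restrictH Φ I g h) where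
  hg := hc.hg.of_sub fun u a hu => (restrictG_eq_some_iff.1 hu).2
  hh := hc.hh.of_sub fun u a hu => (restrictH_eq_some_iff.1 hu).1
  sub u a hu := by
    obtain ⟨-, hgu⟩ := restrictG_eq_some_iff.1 hu
    refine restrictH_eq_some_iff.2 ⟨hc.sub _ _ hgu, mem_union_left _ ?_⟩
    exact mem_img.2 ⟨u, hc.hg.mem _ _ hgu, hu⟩
  imgh u a hu := mem_union.1 (restrictH_eq_some_iff.1 hu).2
  bdh c hcb := by
    have hcb' : c ∈ bd Φ (img Φ g) :=
      bd_mono (img_mono fun u a hu => (restrictG_eq_some_iff.1 hu).2) hcb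
    obtain ⟨u, hu⟩ := hc.bdh c hcb'
    exact ⟨u, restrictH_eq_some_iff.2 ⟨hu, mem_union_right _ hcb⟩⟩

/-- The restricted `g` has domain inside `I`. [folklore] -/
theorem card_dom_restrictG_le (I : Finset ℕ) (g : PMap) : (dom Φ (restrictG I g)).card ≤ I.card := by
  refine card_le_card fun u hu => ?_
  obtain ⟨-, a, ha⟩ := mem_dom.1 hu
  exact (restrictG_eq_some_iff.1 ha).1

/-! #### Claim 7: extension of a condition -/

/-- Step 1 of Claim 7: a target node `u'` for the new line `u`, added to `h` if necessary
(`u' := h(u)` if `u ∈ Dom(h)`; `u' := t(u)` if `u ∈ B_0`; a fresh node of `B*_i` otherwise).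
[cite: AtseriasMuller2020, Claim 7 (proof, choice of u')] -/
theorem exists_target (hG : Φ.Good) {g h : PMap} (hc : IsCond Φ g h)
    (hroom : 3 * (dom Φ g).card < Φ.wB) {u : ℕ} (hu : u ∈ Φ.A) :
    ∃ a h₁, InH Φ h₁ ∧ (∀ v c, h v = some c → h₁ v = some c) ∧ h₁ u = some a ∧
      (∀ v c, h₁ v = some c → h v = some c ∨ (v = u ∧ c = a)) ∧
      (dom Φ h₁).card ≤ (dom Φ h).card + 1 := by
  have hnB : 0 < Φ.nB := by have := hG.K_lt; unfold Frame.nB; omega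
  cases hhu : h u with
  | some a => exact ⟨a, h, hc.hh, fun _ _ h => h, hhu, fun _ _ h => Or.inl h, Nat.le_succ _⟩
  | none =>
    by_cases hcu : Φ.corank u < Φ.c0
    · -- block 0: the node `t(u)` with heap co-number `corank u`
      refine ⟨decodeHeap (Φ.corank u), ext1 h u (decodeHeap (Φ.corank u)), ?_, sub_ext1 _ hhu,
        ext1_self _ _ _, fun v c hv => (ext1_eq_some_iff hhu).1 hv, card_dom_ext1_le _ _ _⟩
      have hlen : (decodeHeap (Φ.corank u)).length ≤ Φ.K :=
        length_decodeHeap_le (by unfold Frame.c0 at hcu; omega)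
      refine hc.hh.ext1 hu hhu (hlen.trans hG.K_lt.le) ?_ (fun _ => heapco_decodeHeap _) ?_
      · unfold Frame.blkT Frame.blk
        rw [(Φ.blkOf_eq_zero_iff hnB).2 hcu]
        omega
      · intro v hv
        have hv0 : Φ.blk v = 0 := by
          rw [← hc.hh.blk _ _ hv]; unfold Frame.blkT; omega
        have hcv : Φ.corank v < Φ.c0 := (Φ.blkOf_eq_zero_iff hnB).1 hv0
        have h1 := hc.hh.heap _ _ hv hcv
        rw [heapco_decodeHeap] at h1
        have := Φ.corank_injOn hu (hc.hh.mem _ _ hv) h1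
        subst this
        rw [hhu] at hv
        simp at hv
    · -- block `i ≥ 1`: a fresh node of level `K + i`
      set i := Φ.blk u with hi
      have hi1 : 1 ≤ i := by
        rw [Nat.one_le_iff_ne_zero]
        intro h0
        exact hcu ((Φ.blkOf_eq_zero_iff hnB).1 h0)
      have hin : i ≤ Φ.nB := Φ.blkOf_le _
      have hcard : (img Φ h).card < (levelNodes (Φ.K + i)).card := by
        rw [card_levelNodes]
        calc (img Φ h).card ≤ (dom Φ h).card := card_img_le h
          _ ≤ 3 * (dom Φ g).card := hc.card_dom_h_le
          _ < Φ.wB := hroom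
          _ ≤ 2 ^ (Φ.K + 1) := hG.wB_le
          _ ≤ 2 ^ (Φ.K + i) := Nat.pow_le_pow_right (by norm_num) (by omega)
      obtain ⟨a, ha, hai⟩ := exists_mem_notMem_of_card_lt_card hcard
      rw [mem_levelNodes_iff] at ha
      refine ⟨a, ext1 h u a, ?_, sub_ext1 _ hhu, ext1_self _ _ _,
        fun v c hv => (ext1_eq_some_iff hhu).1 hv, card_dom_ext1_le _ _ _⟩
      refine hc.hh.ext1 hu hhu ?_ ?_ (fun h' => absurd h' hcu) ?_
      · have := hG.K_lt; unfold Frame.nB at hin; omega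
      · unfold Frame.blkT; rw [ha]; omega
      · intro v hv
        exact hai (mem_img.2 ⟨v, hc.hh.mem _ _ hv, hv⟩)

/-- Step 2 of Claim 7: adding a preimage for one child `c` (the line of co-rank `heapco c` if
`c ∈ B*_0`, a free line of `B_i` otherwise). [cite: AtseriasMuller2020, Claim 7 (proof, choice
of v_0, v_1)] -/
theorem exists_addKid (hG : Φ.Good) {h₁ : PMap} (hH : InH Φ h₁) (hroom : (dom Φ h₁).card < Φ.wB)
    {c : List Bool} (hclen : c.length ≤ Φ.n) :
    ∃ h₂, InH Φ h₂ ∧ (∀ v a, h₁ v = some a → h₂ v = some a) ∧ (∃ v, h₂ v = some c) ∧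
      (∀ v a, h₂ v = some a → h₁ v = some a ∨ a = c) ∧ (dom Φ h₂).card ≤ (dom Φ h₁).card + 1 := by
  have hnB : 0 < Φ.nB := by have := hG.K_lt; unfold Frame.nB; omega
  by_cases hex : ∃ v, h₁ v = some c
  · exact ⟨h₁, hH, fun _ _ h => h, hex, fun _ _ h => Or.inl h, Nat.le_succ _⟩
  have hfresh : ∀ v, h₁ v ≠ some c := fun v hv => hex ⟨v, hv⟩
  by_cases hcK : c.length ≤ Φ.K
  · -- `c ∈ B*_0`: the line with co-rank `heapco c`
    have hcc : heapco c < Φ.c0 := by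
      have h1 := heapco_succ_lt_two_pow c
      have h2 : 2 ^ (c.length + 1) ≤ 2 ^ (Φ.K + 1) := Nat.pow_le_pow_right (by norm_num) (by omega)
      unfold Frame.c0; omega
    have hcs : heapco c < Φ.A.card := by have := hG.fit; omega
    obtain ⟨v, hvA, hvc⟩ := Φ.exists_corank_eq hcs
    have hv0 : Φ.blk v = 0 := (Φ.blkOf_eq_zero_iff hnB).2 (by rw [hvc]; exact hcc)
    have hhv : h₁ v = none := by
      cases hv : h₁ v with
      | none => rfl
      | some a =>
        exfalso
        have h1 := hH.heap _ _ hv (by rw [hvc]; exact hcc)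
        rw [hvc] at h1
        exact hfresh v (by rw [hv, heapco_injective h1])
    refine ⟨ext1 h₁ v c, ?_, sub_ext1 _ hhv, ⟨v, ext1_self _ _ _⟩, fun w a hw => ?_,
      card_dom_ext1_le _ _ _⟩
    · refine hH.ext1 hvA hhv hclen ?_ (fun _ => hvc.symm) hfresh
      unfold Frame.blkT; rw [hv0]; omega
    · rcases (ext1_eq_some_iff hhv).1 hw with hw | ⟨-, rfl⟩
      · exact Or.inl hw
      · exact Or.inr rfl
  · -- `c ∈ B*_i`, `i ≥ 1`: a free line of `B_i`
    obtain ⟨j, hj⟩ : ∃ j, c.length - Φ.K = j + 1 := ⟨c.length - Φ.K - 1, by omega⟩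
    have hin : j + 1 ≤ Φ.nB := by unfold Frame.nB; omega
    have hcard : (dom Φ h₁).card < (Φ.A.filter fun u => Φ.blk u = j + 1).card :=
      lt_of_lt_of_le hroom (Φ.wB_le_card_blk hG hin)
    obtain ⟨v, hv, hvd⟩ := exists_mem_notMem_of_card_lt_card hcard
    obtain ⟨hvA, hvb⟩ := mem_filter.1 hv
    have hhv : h₁ v = none := by
      cases hv' : h₁ v with
      | none => rfl
      | some a => exact absurd (mem_dom.2 ⟨hvA, a, hv'⟩) hvd
    refine ⟨ext1 h₁ v c, ?_, sub_ext1 _ hhv, ⟨v, ext1_self _ _ _⟩, fun w a hw => ?_,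
      card_dom_ext1_le _ _ _⟩
    · refine hH.ext1 hvA hhv hclen ?_ ?_ hfresh
      · unfold Frame.blkT; rw [hvb]; exact hj
      · intro hcv
        have := (Φ.blkOf_eq_zero_iff hnB).2 hcv
        unfold Frame.blk at hvb
        omega
    · rcases (ext1_eq_some_iff hhv).1 hw with hw | ⟨-, rfl⟩
      · exact Or.inl hw
      · exact Or.inr rfl

/-- **Claim 7** of [Atserias–Müller 2020]: a condition with `|Dom(g)|` small extends to a
condition defined at any further active line `u` (the paper tacitly assumes `u ∉ Dom(h)`; when
`u ∈ Dom(h)` one must take `u' := h(u)`, as `exists_target` does).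
[cite: AtseriasMuller2020, Claim 7] -/
theorem IsCond.exists_extend (hG : Φ.Good) {g h : PMap} (hc : IsCond Φ g h)
    (hroom : 3 * ((dom Φ g).card + 1) ≤ Φ.wB) {u : ℕ} (hu : u ∈ Φ.A) (hgu : g u = none) :
    ∃ g₂ h₂, IsCond Φ g₂ h₂ ∧ (∀ v a, g v = some a → g₂ v = some a) ∧
      (∀ v a, h v = some a → h₂ v = some a) ∧ (g₂ u).isSome ∧
      (dom Φ g₂).card ≤ (dom Φ g).card + 1 := by
  obtain ⟨a, h₁, hH₁, hhh₁, h₁u, himg₁, hcard₁⟩ := exists_target hG hc (by omega) hu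
  have hdomh := hc.card_dom_h_le
  have halen : a.length ≤ Φ.n := hH₁.len _ _ h₁u
  -- add the (at most two) children of `a`
  obtain ⟨h₃, hH₃, hhh₃, hkids, himg₃, -⟩ : ∃ h₃, InH Φ h₃ ∧ (∀ v c, h₁ v = some c → h₃ v = some c) ∧
      (∀ c ∈ kids Φ.n a, ∃ v, h₃ v = some c) ∧
      (∀ v c, h₃ v = some c → h₁ v = some c ∨ c ∈ kids Φ.n a) ∧
      (dom Φ h₃).card ≤ (dom Φ h₁).card + 2 := by
    by_cases halt : a.length < Φ.n
    · obtain ⟨h₂, hH₂, hhh₂, ⟨v₀, hv₀⟩, himg₂, hcard₂⟩ :=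
        exists_addKid hG hH₁ (by omega) (c := false :: a) (by simpa using halt)
      obtain ⟨h₃, hH₃, hhh₃, ⟨v₁, hv₁⟩, himg₃, hcard₃⟩ :=
        exists_addKid hG hH₂ (by omega) (c := true :: a) (by simpa using halt)
      refine ⟨h₃, hH₃, fun v c hv => hhh₃ _ _ (hhh₂ _ _ hv), fun c hc => ?_, fun v c hv => ?_, by omega⟩
      · rcases ((mem_kids_iff _).1 hc).2 with rfl | rfl
        · exact ⟨v₀, hhh₃ _ _ hv₀⟩
        · exact ⟨v₁, hv₁⟩
      · rcases himg₃ _ _ hv with hv | rfl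
        · rcases himg₂ _ _ hv with hv | rfl
          · exact Or.inl hv
          · exact Or.inr ((mem_kids_iff _).2 ⟨halt, Or.inl rfl⟩)
        · exact Or.inr ((mem_kids_iff _).2 ⟨halt, Or.inr rfl⟩)
    · refine ⟨h₁, hH₁, fun _ _ h => h, fun c hc => ?_, fun v c hv => Or.inl hv, by omega⟩
      exact absurd ((mem_kids_iff _).1 hc).1 halt
  have hg₂sub : ∀ v b, ext1 g u a v = some b → h₃ v = some b := by
    intro v b hv
    rcases (ext1_eq_some_iff hgu).1 hv with hv | ⟨rfl, rfl⟩
    · exact hhh₃ _ _ (hhh₁ _ _ (hc.sub _ _ hv))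
    · exact hhh₃ _ _ h₁u
  have hgg : ∀ v b, g v = some b → ext1 g u a v = some b := sub_ext1 _ hgu
  refine ⟨ext1 g u a, h₃, ?_, hgg, fun v c hv => hhh₃ _ _ (hhh₁ _ _ hv), by simp [ext1_self],
    card_dom_ext1_le _ _ _⟩
  exact {
    hg := hH₃.of_sub hg₂sub
    hh := hH₃
    sub := hg₂sub
    imgh := by
      intro v b hv
      rcases himg₃ _ _ hv with hv | hkid
      · rcases himg₁ _ _ hv with hv | ⟨rfl, rfl⟩
        · rcases hc.imgh _ _ hv with hb | hb
          · exact Or.inl (img_mono hgg hb)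
          · exact Or.inr (bd_mono (img_mono hgg) hb)
        · exact Or.inl (mem_img.2 ⟨v, hu, ext1_self _ _ _⟩)
      · exact Or.inr (mem_bd.2 ⟨a, mem_img.2 ⟨u, hu, ext1_self _ _ _⟩, hkid⟩)
    bdh := by
      intro c hcb
      obtain ⟨a', ha', hca'⟩ := mem_bd.1 hcb
      obtain ⟨v, hvA, hva'⟩ := mem_img.1 ha'
      rcases (ext1_eq_some_iff hgu).1 hva' with hva' | ⟨rfl, rfl⟩
      · obtain ⟨w, hw⟩ := hc.bdh c (mem_bd.2 ⟨a', mem_img.2 ⟨v, hvA, hva'⟩, hca'⟩)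
        exact ⟨w, hhh₃ _ _ (hhh₁ _ _ hw)⟩
      · exact hkids c hca' }

end Conditions

/-! ### The restriction `ρ` and the merged assignment `μ = ρ ⊕ α(p)` -/

section Rho

variable (Φ : Frame)

/-- Activity of a line index (`false` from `t` on). [cite: AtseriasMuller2020, Lemma 10 (proof:
the set A of active indices)] -/
def Frame.actv (u : ℕ) : Bool := decide (u < Φ.t) && Φ.act u

variable {Φ} in
/-- `actv` is the indicator of `A`. [folklore] -/
theorem Frame.actv_eq_true_iff {u : ℕ} : Φ.actv u = true ↔ u ∈ Φ.A := by
  simp [Frame.actv, Frame.mem_A]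

/-- The restriction `ρ` of [Atserias–Müller 2020, proof of Lemma 10], given the activity bits and
the random values `β`: `P[u] ↦` activity; every other variable mentioning an inactive index gets
its random value; `L[u,v], R[u,v] ↦ 0` for `u` active and `v` inactive; the remaining variables
(mentioning active indices only) stay unassigned.
[cite: AtseriasMuller2020, Lemma 10 (proof: the random restriction ρ, steps 1–4)] -/
def rho (β : RefVar → Bool) : RefVar → Option Bool
  | .P u => some (Φ.actv u)
  | .D u i b => if Φ.actv u then none else some (β (.D u i b))
  | .V u i => if Φ.actv u then none else some (β (.V u i))
  | .I u j => if Φ.actv u then none else some (β (.I u j))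
  | .L u none => if Φ.actv u then none else some (β (.L u none))
  | .R u none => if Φ.actv u then none else some (β (.R u none))
  | .L u (some v) =>
      if Φ.actv u then (if Φ.actv v then none else some false) else some (β (.L u (some v)))
  | .R u (some v) =>
      if Φ.actv u then (if Φ.actv v then none else some false) else some (β (.R u (some v)))

/-- The merged partial assignment `μ = ρ ⊕ α(p)` (`ρ` first): a clause `C` of `RREF` whose
restriction `C|ρ` is falsified by `α(p)` is weakly falsified by `μ`.
[cite: AtseriasMuller2020, Lemma 10 (proof) with Claim 8] -/
def mu (β : RefVar → Bool) (g h : PMap) (x : RefVar) : Option Bool :=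
  (rho Φ β x).or (alpha Φ g h x)

/-- A list clause is weakly falsified by `μ`: every literal is assigned the wrong value.
[folklore] -/
def Falsl (μ : RefVar → Option Bool) (C : Clause RefVar) : Prop :=
  ∀ l ∈ C, μ l.1 = some (!l.2)

variable {Φ} (β : RefVar → Bool) (g h : PMap)

/-- Variables unassigned by `ρ` mention active lines. [cite: AtseriasMuller2020, Lemma 10 (proof: "the clauses of Π|ρ use variables of REF(F,t)" with index set A)] -/
theorem rho_eq_none_imp {x : RefVar} (hx : rho Φ β x = none) : Φ.actv (owner x) = true := by
  cases x with
  | D u i b => simp only [owner]; by_contra h; simp [rho, h] at hx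
  | V u i => simp only [owner]; by_contra h; simp [rho, h] at hx
  | I u j => simp only [owner]; by_contra h; simp [rho, h] at hx
  | L u v =>
    simp only [owner]
    cases v with
    | none => by_contra h; simp [rho, h] at hx
    | some v =>
      by_contra h
      simp only [rho] at hx
      rw [if_neg h] at hx
      simp at hx
  | R u v =>
    simp only [owner]
    cases v with
    | none => by_contra h; simp [rho, h] at hx
    | some v =>
      by_contra h
      simp only [rho] at hx
      rw [if_neg h] at hx
      simp at hx
  | P u => simp [rho] at hx

/-- `μ(P[u])` is the activity bit. [folklore] -/
theorem mu_P (u : ℕ) : mu Φ β g h (.P u) = some (Φ.actv u) := by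
  simp [mu, rho]

variable {β g h}

/-- `μ(D[u,i,b])` for active `u` is `α(p)(D[u,i,b])`. [folklore] -/
theorem mu_D {u : ℕ} (hu : Φ.actv u = true) (i : ℕ) (b : Bool) :
    mu Φ β g h (.D u i b) = (g u).map fun a => Dstar a i b := by
  simp [mu, rho, hu, alpha]

/-- `μ(V[u,i])` for active `u`. [folklore] -/
theorem mu_V {u : ℕ} (hu : Φ.actv u = true) (i : Option ℕ) :
    mu Φ β g h (.V u i) = (g u).map fun a => decide (Vstar Φ.n a = i) := by
  simp [mu, rho, hu, alpha]

/-- `μ(I[u,j])` for active `u`. [folklore] -/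
theorem mu_I {u : ℕ} (hu : Φ.actv u = true) (j : Option ℕ) :
    mu Φ β g h (.I u j) = (g u).map fun a => decide (Istar Φ.n Φ.X Φ.F a = j) := by
  simp [mu, rho, hu, alpha]

/-- `μ(L[u,0])` for active `u`. [folklore] -/
theorem mu_L_none {u : ℕ} (hu : Φ.actv u = true) :
    mu Φ β g h (.L u none) = (g u).map fun a => decide ((kid Φ.n false a).bind (hinv Φ h) = none) := by
  simp [mu, rho, hu, alpha]

/-- `μ(R[u,0])` for active `u`. [folklore] -/
theorem mu_R_none {u : ℕ} (hu : Φ.actv u = true) :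
    mu Φ β g h (.R u none) = (g u).map fun a => decide ((kid Φ.n true a).bind (hinv Φ h) = none) := by
  simp [mu, rho, hu, alpha]

/-- `μ(L[u,v]) = 0` for active `u` and inactive `v` (step 3 of the restriction). [cite: AtseriasMuller2020, Lemma 10 (proof: step 3 of the random restriction)] -/
theorem mu_L_some_of_inactive {u v : ℕ} (hu : Φ.actv u = true) (hv : Φ.actv v = false) :
    mu Φ β g h (.L u (some v)) = some false := by
  simp [mu, rho, hu, hv]

/-- `μ(R[u,v]) = 0` for active `u` and inactive `v`. [cite: AtseriasMuller2020, Lemma 10 (proof: step 3 of the random restriction)] -/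
theorem mu_R_some_of_inactive {u v : ℕ} (hu : Φ.actv u = true) (hv : Φ.actv v = false) :
    mu Φ β g h (.R u (some v)) = some false := by
  simp [mu, rho, hu, hv]

/-- `μ(L[u,v])` for active `u, v`. [folklore] -/
theorem mu_L_some_of_active {u v : ℕ} (hu : Φ.actv u = true) (hv : Φ.actv v = true) :
    mu Φ β g h (.L u (some v)) =
      (g u).map fun a => decide ((kid Φ.n false a).bind (hinv Φ h) = some v) := by
  simp [mu, rho, hu, hv, alpha]

/-- `μ(R[u,v])` for active `u, v`. [folklore] -/
theorem mu_R_some_of_active {u v : ℕ} (hu : Φ.actv u = true) (hv : Φ.actv v = true) :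
    mu Φ β g h (.R u (some v)) =
      (g u).map fun a => decide ((kid Φ.n true a).bind (hinv Φ h) = some v) := by
  simp [mu, rho, hu, hv, alpha]

/-- `μ(L[u,v]) = 1` identifies `v` as `h⁻¹(L*(g(u)))`. [folklore] -/
theorem mu_L_eq_some_true {u : ℕ} (hu : Φ.actv u = true) {v : Option ℕ}
    (hm : mu Φ β g h (.L u v) = some true) :
    ∃ a, g u = some a ∧ (kid Φ.n false a).bind (hinv Φ h) = v := by
  cases v with
  | none =>
    rw [mu_L_none hu] at hm
    cases hgu : g u with
    | none => simp [hgu] at hm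
    | some a => simp only [hgu, Option.map_some, Option.some_inj, decide_eq_true_eq] at hm; exact ⟨a, rfl, hm⟩
  | some v =>
    cases hv : Φ.actv v
    · rw [mu_L_some_of_inactive hu hv] at hm; simp at hm
    · rw [mu_L_some_of_active hu hv] at hm
      cases hgu : g u with
      | none => simp [hgu] at hm
      | some a =>
        simp only [hgu, Option.map_some, Option.some_inj, decide_eq_true_eq] at hm
        exact ⟨a, rfl, hm⟩

/-- `μ(R[u,v]) = 1` identifies `v` as `h⁻¹(R*(g(u)))`. [folklore] -/
theorem mu_R_eq_some_true {u : ℕ} (hu : Φ.actv u = true) {v : Option ℕ}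
    (hm : mu Φ β g h (.R u v) = some true) :
    ∃ a, g u = some a ∧ (kid Φ.n true a).bind (hinv Φ h) = v := by
  cases v with
  | none =>
    rw [mu_R_none hu] at hm
    cases hgu : g u with
    | none => simp [hgu] at hm
    | some a => simp only [hgu, Option.map_some, Option.some_inj, decide_eq_true_eq] at hm; exact ⟨a, rfl, hm⟩
  | some v =>
    cases hv : Φ.actv v
    · rw [mu_R_some_of_inactive hu hv] at hm; simp at hm
    · rw [mu_R_some_of_active hu hv] at hm
      cases hgu : g u with
      | none => simp [hgu] at hm
      | some a =>
        simp only [hgu, Option.map_some, Option.some_inj, decide_eq_true_eq] at hm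
        exact ⟨a, rfl, hm⟩

/-- For a condition, the premise pointer of an internal `g(u)` is defined: `h⁻¹(kid) = some v`
with `h v = kid`. [folklore] -/
theorem kid_bind_hinv {g h : PMap} (hc : IsCond Φ g h) {u : ℕ} {a : List Bool}
    (hu : g u = some a) (halt : a.length < Φ.n) (b : Bool) :
    ∃ v, (kid Φ.n b a).bind (hinv Φ h) = some v ∧ h v = some (b :: a) := by
  have hk : kid Φ.n b a = some (b :: a) := by simp [kid, halt]
  have hcb : (b :: a) ∈ bd Φ (img Φ g) :=
    mem_bd.2 ⟨a, mem_img.2 ⟨u, hc.hg.mem _ _ hu, hu⟩, mem_kids_of_kid _ hk⟩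
  obtain ⟨v, hv⟩ := hc.bdh _ hcb
  exact ⟨v, by rw [hk, Option.bind_some, (hinv_eq_some_iff hc.hh).2 hv], hv⟩

/-- Reading off `h v` from `h⁻¹(kid) = some v`. [folklore] -/
theorem of_kid_bind_hinv_eq_some {h : PMap} (hH : InH Φ h) {a : List Bool} {b : Bool} {v : ℕ}
    (hv : (kid Φ.n b a).bind (hinv Φ h) = some v) : a.length < Φ.n ∧ h v = some (b :: a) := by
  unfold kid at hv
  split_ifs at hv with halt
  · simp only [Option.bind_some] at hv
    exact ⟨halt, (hinv_eq_some_iff hH).1 hv⟩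
  · simp at hv

end Rho

/-! ### Claim 8: no clause of `RREF(F,t)` is weakly falsified by `μ = ρ ⊕ α(p)` -/

section Claim8

variable {Φ : Frame} {β : RefVar → Bool} {g h : PMap}

/-- The hypotheses of Claim 8: a good frame whose last line is active, and a condition.
[cite: AtseriasMuller2020, Claim 8] -/
structure Ctx (Φ : Frame) (g h : PMap) : Prop where
  /-- the frame is good -/
  good : Φ.Good
  /-- `(g,h)` is a condition -/
  cond : IsCond Φ g h
  /-- the last line `t-1` is active -/
  last : Φ.t - 1 ∈ Φ.A

/-- Weak falsification of a cons. [folklore] -/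
theorem falsl_cons_iff {μ : RefVar → Option Bool} {l : Literal RefVar} {C : Clause RefVar} :
    Falsl μ (l :: C) ↔ μ l.1 = some (!l.2) ∧ Falsl μ C := by
  simp [Falsl]

/-- Weak falsification of a concatenation. [folklore] -/
theorem falsl_append_iff {μ : RefVar → Option Bool} {C D : Clause RefVar} :
    Falsl μ (C ++ D) ↔ Falsl μ C ∧ Falsl μ D := by
  simp only [Falsl, List.mem_append]
  exact ⟨fun h => ⟨fun l hl => h l (Or.inl hl), fun l hl => h l (Or.inr hl)⟩,
    fun h l hl => hl.elim (h.1 l) (h.2 l)⟩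

/-- A falsified guard `¬P[u]` means `u` is active. [folklore] -/
theorem falsl_pfx {u : ℕ} {C : Clause RefVar} (hF : Falsl (mu Φ β g h) (RefCNF.pfx true u ++ C)) :
    Φ.actv u = true ∧ Falsl (mu Φ β g h) C := by
  rw [falsl_append_iff] at hF
  refine ⟨?_, hF.2⟩
  have := hF.1 (RefVar.P u, false) (by simp [RefCNF.pfx])
  rw [mu_P] at this
  simpa using this

/-- Membership in the index range `{0} ∪ [k]`. [folklore] -/
theorem mem_optRange_iff {k : ℕ} {i : Option ℕ} :
    i ∈ RefCNF.optRange k ↔ i = none ∨ ∃ j < k, i = some j := by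
  simp only [RefCNF.optRange, List.mem_cons, List.mem_map, List.mem_range]
  constructor
  · rintro (h | ⟨j, hj, rfl⟩)
    · exact Or.inl h
    · exact Or.inr ⟨j, hj, rfl⟩
  · rintro (h | ⟨j, hj, rfl⟩)
    · exact Or.inl h
    · exact Or.inr ⟨j, hj, rfl⟩

/-- `V*` takes values in `{0} ∪ [n]`. [folklore] -/
theorem vstar_mem_optRange (n : ℕ) (a : List Bool) : Vstar n a ∈ RefCNF.optRange n := by
  rw [mem_optRange_iff]
  unfold Vstar
  split_ifs with h
  · exact Or.inr ⟨_, h, rfl⟩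
  · exact Or.inl rfl

/-- From a `μ`-value of a `g`-described variable, read off `g(u)`. [folklore] -/
theorem exists_of_map_eq_some {γ : Type*} {o : Option (List Bool)} {f : List Bool → γ} {c : γ}
    (ho : o.map f = some c) : ∃ a, o = some a ∧ f a = c :=
  Option.map_eq_some_iff.1 ho

/-- (A1) is not weakly falsified. [cite: AtseriasMuller2020, Claim 8 (case (A1))] -/
theorem nfal_A1 (hx : Ctx Φ g h) : ∀ C ∈ RefCNF.A1 true Φ.t Φ.X.length, ¬ Falsl (mu Φ β g h) C := by
  intro C hC hF
  rw [hx.good.length_X] at hC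
  simp only [RefCNF.A1, List.mem_map, List.mem_range] at hC
  obtain ⟨u, -, rfl⟩ := hC
  obtain ⟨hu, hF⟩ := falsl_pfx hF
  have h0 := hF (RefVar.V u none, true) (List.mem_map.2 ⟨none, by simp [RefCNF.optRange], rfl⟩)
  rw [mu_V hu] at h0
  obtain ⟨a, hgu, -⟩ := exists_of_map_eq_some h0
  have h1 := hF (RefVar.V u (Vstar Φ.n a), true) (List.mem_map.2 ⟨_, vstar_mem_optRange _ _, rfl⟩)
  rw [mu_V hu, hgu] at h1
  simp at h1

/-- (A2) is not weakly falsified. [cite: AtseriasMuller2020, Claim 8 (case (A2))] -/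
theorem nfal_A2 (hx : Ctx Φ g h) : ∀ C ∈ RefCNF.A2 true Φ.t Φ.F.length, ¬ Falsl (mu Φ β g h) C := by
  intro C hC hF
  simp only [RefCNF.A2, List.mem_map, List.mem_range] at hC
  obtain ⟨u, -, rfl⟩ := hC
  obtain ⟨hu, hF⟩ := falsl_pfx hF
  have h0 := hF (RefVar.I u none, true) (List.mem_map.2 ⟨none, by simp [RefCNF.optRange], rfl⟩)
  rw [mu_I hu] at h0
  obtain ⟨a, hgu, -⟩ := exists_of_map_eq_some h0
  have hmem : Istar Φ.n Φ.X Φ.F a ∈ RefCNF.optRange Φ.F.length := by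
    rw [mem_optRange_iff]
    unfold Istar
    split_ifs with h
    · exact Or.inl rfl
    · exact Or.inr ⟨_, (leafClause_spec hx.good.unsat Φ.X a).1, rfl⟩
  have h1 := hF (RefVar.I u (Istar Φ.n Φ.X Φ.F a), true) (List.mem_map.2 ⟨_, hmem, rfl⟩)
  rw [mu_I hu, hgu] at h1
  simp at h1

/-- (A3) is not weakly falsified. [cite: AtseriasMuller2020, Claim 8 (case (A3))] -/
theorem nfal_A3 (hx : Ctx Φ g h) : ∀ C ∈ RefCNF.A3 true Φ.t, ¬ Falsl (mu Φ β g h) C := by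
  intro C hC hF
  simp only [RefCNF.A3, List.mem_map, List.mem_range] at hC
  obtain ⟨u, -, rfl⟩ := hC
  obtain ⟨hu, hF⟩ := falsl_pfx hF
  have h0 := hF (RefVar.L u none, true) (List.mem_map.2 ⟨none, by simp [RefCNF.optRange], rfl⟩)
  rw [mu_L_none hu] at h0
  obtain ⟨a, hgu, ha⟩ := exists_of_map_eq_some h0
  simp only [Bool.not_true, decide_eq_false_iff_not] at ha
  obtain ⟨v, hv⟩ := Option.ne_none_iff_exists'.1 ha
  obtain ⟨-, hhv⟩ := of_kid_bind_hinv_eq_some hx.cond.hh hv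
  have hvA := hx.cond.hh.mem _ _ hhv
  have hvt : v < Φ.t := (Φ.mem_A.1 hvA).1
  have hva : Φ.actv v = true := Frame.actv_eq_true_iff.2 hvA
  have h1 := hF (RefVar.L u (some v), true)
    (List.mem_map.2 ⟨some v, mem_optRange_iff.2 (Or.inr ⟨v, hvt, rfl⟩), rfl⟩)
  rw [mu_L_some_of_active hu hva, hgu] at h1
  simp [hv] at h1

/-- (A4) is not weakly falsified. [cite: AtseriasMuller2020, Claim 8 (case (A4))] -/
theorem nfal_A4 (hx : Ctx Φ g h) : ∀ C ∈ RefCNF.A4 true Φ.t, ¬ Falsl (mu Φ β g h) C := by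
  intro C hC hF
  simp only [RefCNF.A4, List.mem_map, List.mem_range] at hC
  obtain ⟨u, -, rfl⟩ := hC
  obtain ⟨hu, hF⟩ := falsl_pfx hF
  have h0 := hF (RefVar.R u none, true) (List.mem_map.2 ⟨none, by simp [RefCNF.optRange], rfl⟩)
  rw [mu_R_none hu] at h0
  obtain ⟨a, hgu, ha⟩ := exists_of_map_eq_some h0
  simp only [Bool.not_true, decide_eq_false_iff_not] at ha
  obtain ⟨v, hv⟩ := Option.ne_none_iff_exists'.1 ha
  obtain ⟨-, hhv⟩ := of_kid_bind_hinv_eq_some hx.cond.hh hv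
  have hvA := hx.cond.hh.mem _ _ hhv
  have hvt : v < Φ.t := (Φ.mem_A.1 hvA).1
  have hva : Φ.actv v = true := Frame.actv_eq_true_iff.2 hvA
  have h1 := hF (RefVar.R u (some v), true)
    (List.mem_map.2 ⟨some v, mem_optRange_iff.2 (Or.inr ⟨v, hvt, rfl⟩), rfl⟩)
  rw [mu_R_some_of_active hu hva, hgu] at h1
  simp [hv] at h1

/-- (A5) is not weakly falsified. [cite: AtseriasMuller2020, Claim 8 (case (A5))] -/
theorem nfal_A5 : ∀ C ∈ RefCNF.A5 true Φ.t Φ.X.length, ¬ Falsl (mu Φ β g h) C := by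
  intro C hC hF
  simp only [RefCNF.A5, List.mem_flatMap, List.mem_map, List.mem_filter, List.mem_range] at hC
  obtain ⟨u, -, i, -, i', ⟨-, hne⟩, rfl⟩ := hC
  obtain ⟨hu, hF⟩ := falsl_pfx hF
  rw [falsl_cons_iff, falsl_cons_iff] at hF
  obtain ⟨h1, h2, -⟩ := hF
  rw [mu_V hu] at h1 h2
  obtain ⟨a, hgu, ha⟩ := exists_of_map_eq_some h1
  obtain ⟨a', hgu', ha'⟩ := exists_of_map_eq_some h2
  rw [hgu] at hgu'
  cases hgu'
  simp only [Bool.not_false, decide_eq_true_eq] at ha ha'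
  rw [ha] at ha'
  simp [ha'] at hne

/-- (A6) is not weakly falsified. [cite: AtseriasMuller2020, Claim 8 (case (A6))] -/
theorem nfal_A6 : ∀ C ∈ RefCNF.A6 true Φ.t Φ.F.length, ¬ Falsl (mu Φ β g h) C := by
  intro C hC hF
  simp only [RefCNF.A6, List.mem_flatMap, List.mem_map, List.mem_filter, List.mem_range] at hC
  obtain ⟨u, -, j, -, j', ⟨-, hne⟩, rfl⟩ := hC
  obtain ⟨hu, hF⟩ := falsl_pfx hF
  rw [falsl_cons_iff, falsl_cons_iff] at hF
  obtain ⟨h1, h2, -⟩ := hF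
  rw [mu_I hu] at h1 h2
  obtain ⟨a, hgu, ha⟩ := exists_of_map_eq_some h1
  obtain ⟨a', hgu', ha'⟩ := exists_of_map_eq_some h2
  rw [hgu] at hgu'
  cases hgu'
  simp only [Bool.not_false, decide_eq_true_eq] at ha ha'
  rw [ha] at ha'
  simp [ha'] at hne

/-- (A7) is not weakly falsified. [cite: AtseriasMuller2020, Claim 8 (case (A7))] -/
theorem nfal_A7 : ∀ C ∈ RefCNF.A7 true Φ.t, ¬ Falsl (mu Φ β g h) C := by
  intro C hC hF
  simp only [RefCNF.A7, List.mem_flatMap, List.mem_map, List.mem_filter, List.mem_range] at hC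
  obtain ⟨u, -, v, -, v', ⟨-, hne⟩, rfl⟩ := hC
  obtain ⟨hu, hF⟩ := falsl_pfx hF
  rw [falsl_cons_iff, falsl_cons_iff] at hF
  obtain ⟨h1, h2, -⟩ := hF
  obtain ⟨a, hgu, ha⟩ := mu_L_eq_some_true hu h1
  obtain ⟨a', hgu', ha'⟩ := mu_L_eq_some_true hu h2
  rw [hgu] at hgu'
  cases hgu'
  rw [ha] at ha'
  simp [ha'] at hne

/-- (A8) is not weakly falsified. [cite: AtseriasMuller2020, Claim 8 (case (A8))] -/
theorem nfal_A8 : ∀ C ∈ RefCNF.A8 true Φ.t, ¬ Falsl (mu Φ β g h) C := by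
  intro C hC hF
  simp only [RefCNF.A8, List.mem_flatMap, List.mem_map, List.mem_filter, List.mem_range] at hC
  obtain ⟨u, -, v, -, v', ⟨-, hne⟩, rfl⟩ := hC
  obtain ⟨hu, hF⟩ := falsl_pfx hF
  rw [falsl_cons_iff, falsl_cons_iff] at hF
  obtain ⟨h1, h2, -⟩ := hF
  obtain ⟨a, hgu, ha⟩ := mu_R_eq_some_true hu h1
  obtain ⟨a', hgu', ha'⟩ := mu_R_eq_some_true hu h2
  rw [hgu] at hgu'
  cases hgu'
  rw [ha] at ha'
  simp [ha'] at hne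

/-- (A9) is not weakly falsified. [cite: AtseriasMuller2020, Claim 8 (case (A9))] -/
theorem nfal_A9 : ∀ C ∈ RefCNF.A9 true Φ.t, ¬ Falsl (mu Φ β g h) C := by
  intro C hC hF
  simp only [RefCNF.A9, List.mem_map, List.mem_range] at hC
  obtain ⟨u, -, rfl⟩ := hC
  obtain ⟨hu, hF⟩ := falsl_pfx hF
  rw [falsl_cons_iff, falsl_cons_iff] at hF
  obtain ⟨h1, h2, -⟩ := hF
  rw [mu_I hu] at h1
  rw [mu_V hu] at h2
  obtain ⟨a, hgu, ha⟩ := exists_of_map_eq_some h1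
  obtain ⟨a', hgu', ha'⟩ := exists_of_map_eq_some h2
  rw [hgu] at hgu'
  cases hgu'
  simp only [Bool.not_false, decide_eq_true_eq, Istar, Vstar] at ha ha'
  split_ifs at ha ha'

/-- (A10) is not weakly falsified. [cite: AtseriasMuller2020, Claim 8 (case (A10))] -/
theorem nfal_A10 : ∀ C ∈ RefCNF.A10 true Φ.t, ¬ Falsl (mu Φ β g h) C := by
  intro C hC hF
  simp only [RefCNF.A10, List.mem_map, List.mem_range] at hC
  obtain ⟨u, -, rfl⟩ := hC
  obtain ⟨hu, hF⟩ := falsl_pfx hF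
  rw [falsl_cons_iff, falsl_cons_iff] at hF
  obtain ⟨h1, h2, -⟩ := hF
  rw [mu_I hu] at h1
  rw [mu_V hu] at h2
  obtain ⟨a, hgu, ha⟩ := exists_of_map_eq_some h1
  obtain ⟨a', hgu', ha'⟩ := exists_of_map_eq_some h2
  rw [hgu] at hgu'
  cases hgu'
  simp only [Bool.not_true, decide_eq_false_iff_not, Istar, Vstar] at ha ha'
  split_ifs at ha ha' <;> simp_all

/-- (A11) is not weakly falsified. [cite: AtseriasMuller2020, Claim 8 (case (A11))] -/
theorem nfal_A11 (hx : Ctx Φ g h) : ∀ C ∈ RefCNF.A11 true Φ.t, ¬ Falsl (mu Φ β g h) C := by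
  intro C hC hF
  simp only [RefCNF.A11, List.mem_map, List.mem_range] at hC
  obtain ⟨u, -, rfl⟩ := hC
  obtain ⟨hu, hF⟩ := falsl_pfx hF
  rw [falsl_cons_iff, falsl_cons_iff] at hF
  obtain ⟨h1, h2, -⟩ := hF
  rw [mu_I hu] at h1
  obtain ⟨a, hgu, ha⟩ := exists_of_map_eq_some h1
  obtain ⟨a', hgu', ha'⟩ := mu_L_eq_some_true hu h2
  rw [hgu] at hgu'
  cases hgu'
  simp only [Bool.not_false, decide_eq_true_eq, Istar] at ha
  split_ifs at ha with halt
  obtain ⟨v, hv, -⟩ := kid_bind_hinv hx.cond hgu halt false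
  rw [ha'] at hv
  simp at hv

/-- (A12) is not weakly falsified. [cite: AtseriasMuller2020, Claim 8 (case (A12))] -/
theorem nfal_A12 (hx : Ctx Φ g h) : ∀ C ∈ RefCNF.A12 true Φ.t, ¬ Falsl (mu Φ β g h) C := by
  intro C hC hF
  simp only [RefCNF.A12, List.mem_map, List.mem_range] at hC
  obtain ⟨u, -, rfl⟩ := hC
  obtain ⟨hu, hF⟩ := falsl_pfx hF
  rw [falsl_cons_iff, falsl_cons_iff] at hF
  obtain ⟨h1, h2, -⟩ := hF
  rw [mu_I hu] at h1
  obtain ⟨a, hgu, ha⟩ := exists_of_map_eq_some h1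
  obtain ⟨a', hgu', ha'⟩ := mu_R_eq_some_true hu h2
  rw [hgu] at hgu'
  cases hgu'
  simp only [Bool.not_false, decide_eq_true_eq, Istar] at ha
  split_ifs at ha with halt
  obtain ⟨v, hv, -⟩ := kid_bind_hinv hx.cond hgu halt true
  rw [ha'] at hv
  simp at hv

/-- (A13) is not weakly falsified: premises of active lines are EARLIER active lines (Claim 5).
[cite: AtseriasMuller2020, Claim 8 (case (A13))] -/
theorem nfal_A13 (hx : Ctx Φ g h) : ∀ C ∈ RefCNF.A13 true Φ.t, ¬ Falsl (mu Φ β g h) C := by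
  intro C hC hF
  simp only [RefCNF.A13, List.mem_flatMap, List.mem_map, List.mem_filter, List.mem_range] at hC
  obtain ⟨u, -, v, ⟨-, huv⟩, rfl⟩ := hC
  obtain ⟨hu, hF⟩ := falsl_pfx hF
  rw [falsl_cons_iff] at hF
  obtain ⟨h1, -⟩ := hF
  obtain ⟨a, hgu, ha⟩ := mu_L_eq_some_true hu h1
  obtain ⟨halt, hhv⟩ := of_kid_bind_hinv_eq_some hx.cond.hh ha
  have hlt := hx.cond.hh.lt_of_kid hx.good (hx.cond.sub _ _ hgu)
    ((mem_kids_iff _).2 ⟨halt, Or.inl rfl⟩) hhv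
  simp only [decide_eq_true_eq] at huv
  omega

/-- (A14) is not weakly falsified. [cite: AtseriasMuller2020, Claim 8 (case (A14))] -/
theorem nfal_A14 (hx : Ctx Φ g h) : ∀ C ∈ RefCNF.A14 true Φ.t, ¬ Falsl (mu Φ β g h) C := by
  intro C hC hF
  simp only [RefCNF.A14, List.mem_flatMap, List.mem_map, List.mem_filter, List.mem_range] at hC
  obtain ⟨u, -, v, ⟨-, huv⟩, rfl⟩ := hC
  obtain ⟨hu, hF⟩ := falsl_pfx hF
  rw [falsl_cons_iff] at hF
  obtain ⟨h1, -⟩ := hF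
  obtain ⟨a, hgu, ha⟩ := mu_R_eq_some_true hu h1
  obtain ⟨halt, hhv⟩ := of_kid_bind_hinv_eq_some hx.cond.hh ha
  have hlt := hx.cond.hh.lt_of_kid hx.good (hx.cond.sub _ _ hgu)
    ((mem_kids_iff _).2 ⟨halt, Or.inr rfl⟩) hhv
  simp only [decide_eq_true_eq] at huv
  omega

/-- Common core of (A15)–(A18): from `μ(L[u,v]) = μ(V[u,i]) = 1` read off `g(u) = a` internal of
level `i` and `g(v) = h(v) =` the `b₀`-child of `a`. [folklore] -/
theorem cut_data (hx : Ctx Φ g h) {u v i : ℕ} {b₀ : Bool} (hu : Φ.actv u = true)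
    (hL : mu Φ β g h (if b₀ then .R u (some v) else .L u (some v)) = some true)
    (hV : mu Φ β g h (.V u (some i)) = some true) :
    ∃ a, g u = some a ∧ a.length = i ∧ i < Φ.n ∧ h v = some (b₀ :: a) ∧
      ∀ c, g v = some c → c = b₀ :: a := by
  have hL' : ∃ a, g u = some a ∧ (kid Φ.n b₀ a).bind (hinv Φ h) = some v := by
    cases b₀
    · exact mu_L_eq_some_true hu (by simpa using hL)
    · exact mu_R_eq_some_true hu (by simpa using hL)
  obtain ⟨a, hgu, ha⟩ := hL'
  obtain ⟨halt, hhv⟩ := of_kid_bind_hinv_eq_some hx.cond.hh ha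
  rw [mu_V hu, hgu] at hV
  simp only [Option.map_some, Option.some_inj, decide_eq_true_eq, Vstar, if_pos halt] at hV
  refine ⟨a, hgu, hV, hV ▸ halt, hhv, fun c hc => ?_⟩
  have := hx.cond.sub _ _ hc
  rw [hhv] at this
  cases this
  rfl

/-- (A15) is not weakly falsified. [cite: AtseriasMuller2020, Claim 8 (case (A15))] -/
theorem nfal_A15 (hx : Ctx Φ g h) : ∀ C ∈ RefCNF.A15 true Φ.t Φ.X.length, ¬ Falsl (mu Φ β g h) C := by
  intro C hC hF
  simp only [RefCNF.A15, List.mem_flatMap, List.mem_map, List.mem_range] at hC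
  obtain ⟨u, -, v, -, i, -, rfl⟩ := hC
  obtain ⟨hu, hF⟩ := falsl_pfx hF
  obtain ⟨hv, hF⟩ := falsl_pfx hF
  rw [falsl_cons_iff, falsl_cons_iff, falsl_cons_iff] at hF
  obtain ⟨h1, h2, h3, -⟩ := hF
  obtain ⟨a, hgu, hai, hin, hhv, hgv⟩ := cut_data hx (b₀ := false) hu (by simpa using h1) h2
  rw [mu_D hv] at h3
  obtain ⟨c, hgvc, hc⟩ := exists_of_map_eq_some h3
  rw [hgv c hgvc, ← hai] at hc
  simp [Dstar, bitAt_cons_length] at hc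

/-- (A16) is not weakly falsified. [cite: AtseriasMuller2020, Claim 8 (case (A16))] -/
theorem nfal_A16 (hx : Ctx Φ g h) : ∀ C ∈ RefCNF.A16 true Φ.t Φ.X.length, ¬ Falsl (mu Φ β g h) C := by
  intro C hC hF
  simp only [RefCNF.A16, List.mem_flatMap, List.mem_map, List.mem_range] at hC
  obtain ⟨u, -, v, -, i, -, rfl⟩ := hC
  obtain ⟨hu, hF⟩ := falsl_pfx hF
  obtain ⟨hv, hF⟩ := falsl_pfx hF
  rw [falsl_cons_iff, falsl_cons_iff, falsl_cons_iff] at hF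
  obtain ⟨h1, h2, h3, -⟩ := hF
  obtain ⟨a, hgu, hai, hin, hhv, hgv⟩ := cut_data hx (b₀ := true) hu (by simpa using h1) h2
  rw [mu_D hv] at h3
  obtain ⟨c, hgvc, hc⟩ := exists_of_map_eq_some h3
  rw [hgv c hgvc, ← hai] at hc
  simp [Dstar, bitAt_cons_length] at hc

/-- Common core of (A17)–(A18): a literal other than the pivot is inherited from the premise.
[folklore] -/
theorem keep_data {a : List Bool} {b₀ b : Bool} {i' : ℕ} (hne : i' ≠ a.length)
    (h3 : Dstar (b₀ :: a) i' b = true) (h4 : Dstar a i' b = false) : False := by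
  simp only [Dstar, decide_eq_true_eq, decide_eq_false_iff_not] at h3 h4
  rcases Nat.lt_or_gt_of_ne hne with hlt | hgt
  · rw [bitAt_cons_of_lt _ hlt] at h3
    exact h4 h3
  · rw [bitAt_eq_none (by simp; omega)] at h3
    simp at h3

/-- (A17) is not weakly falsified. [cite: AtseriasMuller2020, Claim 8 (case (A17))] -/
theorem nfal_A17 (hx : Ctx Φ g h) : ∀ C ∈ RefCNF.A17 true Φ.t Φ.X.length, ¬ Falsl (mu Φ β g h) C := by
  intro C hC hF
  simp only [RefCNF.A17, List.mem_flatMap, List.mem_map, List.mem_filter, List.mem_range,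
    List.mem_cons, List.not_mem_nil, or_false] at hC
  obtain ⟨u, -, v, -, i, -, i', ⟨-, hne⟩, b, -, rfl⟩ := hC
  obtain ⟨hu, hF⟩ := falsl_pfx hF
  obtain ⟨hv, hF⟩ := falsl_pfx hF
  rw [falsl_cons_iff, falsl_cons_iff, falsl_cons_iff, falsl_cons_iff] at hF
  obtain ⟨h1, h2, h3, h4, -⟩ := hF
  obtain ⟨a, hgu, hai, hin, hhv, hgv⟩ := cut_data hx (b₀ := false) hu (by simpa using h1) h2
  rw [mu_D hv] at h3
  rw [mu_D hu, hgu] at h4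
  obtain ⟨c, hgvc, hc⟩ := exists_of_map_eq_some h3
  rw [hgv c hgvc] at hc
  simp only [Option.map_some, Option.some_inj, Bool.not_true, Bool.not_false] at hc h4
  simp only [decide_eq_true_eq] at hne
  exact keep_data (by rw [hai]; exact hne) hc h4

/-- (A18) is not weakly falsified. [cite: AtseriasMuller2020, Claim 8 (case (A18))] -/
theorem nfal_A18 (hx : Ctx Φ g h) : ∀ C ∈ RefCNF.A18 true Φ.t Φ.X.length, ¬ Falsl (mu Φ β g h) C := by
  intro C hC hF
  simp only [RefCNF.A18, List.mem_flatMap, List.mem_map, List.mem_filter, List.mem_range,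
    List.mem_cons, List.not_mem_nil, or_false] at hC
  obtain ⟨u, -, v, -, i, -, i', ⟨-, hne⟩, b, -, rfl⟩ := hC
  obtain ⟨hu, hF⟩ := falsl_pfx hF
  obtain ⟨hv, hF⟩ := falsl_pfx hF
  rw [falsl_cons_iff, falsl_cons_iff, falsl_cons_iff, falsl_cons_iff] at hF
  obtain ⟨h1, h2, h3, h4, -⟩ := hF
  obtain ⟨a, hgu, hai, hin, hhv, hgv⟩ := cut_data hx (b₀ := true) hu (by simpa using h1) h2
  rw [mu_D hv] at h3
  rw [mu_D hu, hgu] at h4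
  obtain ⟨c, hgvc, hc⟩ := exists_of_map_eq_some h3
  rw [hgv c hgvc] at hc
  simp only [Option.map_some, Option.some_inj, Bool.not_true, Bool.not_false] at hc h4
  simp only [decide_eq_true_eq] at hne
  exact keep_data (by rw [hai]; exact hne) hc h4

/-- (A19) is not weakly falsified: the leaf clause `C_a` is a weakening of the falsified clause
`C_j` of `F`. [cite: AtseriasMuller2020, Claim 8 (case (A19))] -/
theorem nfal_A19 (hx : Ctx Φ g h) : ∀ C ∈ RefCNF.A19 true Φ.X Φ.F Φ.t, ¬ Falsl (mu Φ β g h) C := by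
  intro C hC hF
  simp only [RefCNF.A19, List.mem_flatMap, List.mem_map, List.mem_range] at hC
  obtain ⟨u, -, j, hj, l, hl, rfl⟩ := hC
  obtain ⟨hu, hF⟩ := falsl_pfx hF
  rw [falsl_cons_iff, falsl_cons_iff] at hF
  obtain ⟨h1, h2, -⟩ := hF
  rw [mu_I hu] at h1
  obtain ⟨a, hgu, ha⟩ := exists_of_map_eq_some h1
  rw [mu_D hu, hgu] at h2
  simp only [Bool.not_false, decide_eq_true_eq, Istar] at ha
  split_ifs at ha with halt
  simp only [Option.some_inj] at ha
  have halen : a.length = Φ.n := le_antisymm (hx.cond.hg.len _ _ hgu) (not_lt.1 halt)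
  obtain ⟨-, heval⟩ := leafClause_spec hx.good.unsat Φ.X a
  rw [ha] at heval
  have hlit : Literal.eval (leafAssign Φ.X a) l = false := by
    have := List.any_eq_false.1 heval l hl
    simpa using this
  have hcF : Φ.F.getD j [] ∈ Φ.F := by
    rw [List.getD_eq_getElem?_getD, List.getElem?_eq_getElem hj, Option.getD_some]
    exact List.getElem_mem hj
  have hxX : l.1 ∈ Φ.X := hx.good.mem_X _ hcF l hl
  have hidx : Φ.X.idxOf l.1 < a.length := by
    rw [halen, ← hx.good.length_X]; exact List.idxOf_lt_length_of_mem hxX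
  obtain ⟨c, hc⟩ := bitAt_isSome hidx
  simp only [Literal.eval, leafAssign, hc] at hlit
  simp only [Option.map_some, Option.some_inj, Bool.not_true, Dstar, hc, decide_eq_false_iff_not,
    Option.some_inj] at h2
  cases c <;> cases hb : l.2 <;> simp_all

/-- (A20) is not weakly falsified. [cite: AtseriasMuller2020, Claim 8 (case (A20))] -/
theorem nfal_A20 : ∀ C ∈ RefCNF.A20 true Φ.t Φ.X.length, ¬ Falsl (mu Φ β g h) C := by
  intro C hC hF
  simp only [RefCNF.A20, List.mem_flatMap, List.mem_map, List.mem_range] at hC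
  obtain ⟨u, -, i, -, rfl⟩ := hC
  obtain ⟨hu, hF⟩ := falsl_pfx hF
  rw [falsl_cons_iff, falsl_cons_iff] at hF
  obtain ⟨h1, h2, -⟩ := hF
  rw [mu_D hu] at h1 h2
  obtain ⟨a, hgu, ha⟩ := exists_of_map_eq_some h1
  obtain ⟨a', hgu', ha'⟩ := exists_of_map_eq_some h2
  rw [hgu] at hgu'
  cases hgu'
  simp only [Bool.not_false, Dstar, decide_eq_true_eq] at ha ha'
  rw [ha] at ha'
  simp at ha'

/-- Only the root has heap co-number `0`. [folklore] -/
theorem eq_nil_of_heapco_eq_zero {a : List Bool} (h : heapco a = 0) : a = [] := by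
  cases a with
  | nil => rfl
  | cons b a => simp [heapco] at h

/-- (A21) is not weakly falsified: the last line is mapped to the root, the empty clause.
[cite: AtseriasMuller2020, Claim 8 (case (A21))] -/
theorem nfal_A21 (hx : Ctx Φ g h) : ∀ C ∈ RefCNF.A21 true Φ.t Φ.X.length, ¬ Falsl (mu Φ β g h) C := by
  intro C hC hF
  simp only [RefCNF.A21, List.mem_flatMap, List.mem_map, List.mem_filter, List.mem_range,
    List.mem_cons, List.not_mem_nil, or_false, decide_eq_true_eq] at hC
  obtain ⟨u, ⟨-, hut⟩, i, -, b, -, rfl⟩ := hC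
  obtain ⟨hu, hF⟩ := falsl_pfx hF
  rw [falsl_cons_iff] at hF
  obtain ⟨h1, -⟩ := hF
  rw [mu_D hu] at h1
  obtain ⟨a, hgu, ha⟩ := exists_of_map_eq_some h1
  simp only [Bool.not_false, Dstar, decide_eq_true_eq] at ha
  have hi := lt_length_of_bitAt_eq_some ha
  have hu' : u = Φ.t - 1 := by omega
  have hc0 : Φ.corank u < Φ.c0 := by
    rw [hu', Φ.corank_last (by omega)]
    unfold Frame.c0
    have : 1 < 2 ^ (Φ.K + 1) := Nat.one_lt_two_pow (by omega)
    omega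
  have hheap := hx.cond.hg.heap _ _ hgu hc0
  rw [hu', Φ.corank_last (by omega)] at hheap
  rw [eq_nil_of_heapco_eq_zero hheap] at hi
  simp at hi

/-- (A22) is satisfied by `ρ` (hence not weakly falsified). [cite: AtseriasMuller2020, Lemma 10
(proof: "C|ρ = 1 for C a clause of type (A22) or (A23)")] -/
theorem nfal_A22 : ∀ C ∈ RefCNF.A22 Φ.t, ¬ Falsl (mu Φ β g h) C := by
  intro C hC hF
  simp only [RefCNF.A22, List.mem_flatMap, List.mem_map, List.mem_range] at hC
  obtain ⟨u, -, v, -, rfl⟩ := hC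
  rw [falsl_cons_iff, falsl_cons_iff, falsl_cons_iff] at hF
  obtain ⟨h0, h1, h2, -⟩ := hF
  rw [mu_P] at h0 h2
  simp only [Bool.not_false, Option.some_inj, Bool.not_true] at h0 h2
  rw [mu_L_some_of_inactive h0 h2] at h1
  simp at h1

/-- (A23) is satisfied by `ρ`. [cite: AtseriasMuller2020, Lemma 10 (proof, clauses (A23))] -/
theorem nfal_A23 : ∀ C ∈ RefCNF.A23 Φ.t, ¬ Falsl (mu Φ β g h) C := by
  intro C hC hF
  simp only [RefCNF.A23, List.mem_flatMap, List.mem_map, List.mem_range] at hC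
  obtain ⟨u, -, v, -, rfl⟩ := hC
  rw [falsl_cons_iff, falsl_cons_iff, falsl_cons_iff] at hF
  obtain ⟨h0, h1, h2, -⟩ := hF
  rw [mu_P] at h0 h2
  simp only [Bool.not_false, Option.some_inj, Bool.not_true] at h0 h2
  rw [mu_R_some_of_inactive h0 h2] at h1
  simp at h1

/-- (A24) is satisfied by `ρ` (the last line is active). [cite: AtseriasMuller2020, Lemma 10
(proof: "By (iii), ρ satisfies (A24)")] -/
theorem nfal_A24 (hx : Ctx Φ g h) : ∀ C ∈ RefCNF.A24 Φ.t, ¬ Falsl (mu Φ β g h) C := by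
  intro C hC hF
  simp only [RefCNF.A24, List.mem_map, List.mem_filter, List.mem_range, decide_eq_true_eq] at hC
  obtain ⟨u, ⟨-, hut⟩, rfl⟩ := hC
  rw [falsl_cons_iff] at hF
  obtain ⟨h0, -⟩ := hF
  rw [mu_P] at h0
  simp only [Bool.not_true, Option.some_inj] at h0
  have hu' : u = Φ.t - 1 := by omega
  have := Frame.actv_eq_true_iff.2 (hu' ▸ hx.last)
  rw [h0] at this
  exact Bool.false_ne_true this

/-- **Claim 8** of [Atserias–Müller 2020], fused with the case analysis "C|ρ = 1 or
C|ρ ∈ REF(F,A)" of the proof of Lemma 10: no clause of `RREF(F,t)` is weakly falsified by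
`μ = ρ ⊕ α(p)`, i.e. `α(p)` falsifies no axiom of `RREF(F,t)|ρ`.
[cite: AtseriasMuller2020, Claim 8 and Lemma 10 (proof)] -/
theorem nfal_rref (hx : Ctx Φ g h) (C : Clause RefVar) (hC : C ∈ RefCNF.rref Φ.X Φ.F Φ.t) :
    ¬ Falsl (mu Φ β g h) C := by
  have H : ∀ {l₁ l₂ : CNF RefVar}, C ∈ l₁ ++ l₂ → (C ∈ l₁ → ¬ Falsl (mu Φ β g h) C) →
      (∀ C ∈ l₂, ¬ Falsl (mu Φ β g h) C) → ¬ Falsl (mu Φ β g h) C :=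
    fun h h1 h2 => (List.mem_append.1 h).elim h1 (h2 C)
  rw [RefCNF.rref_eq] at hC
  refine H hC (fun hC => ?_) (nfal_A24 hx)
  refine H hC (fun hC => ?_) nfal_A23
  refine H hC (fun hC => ?_) nfal_A22
  unfold RefCNF.blocks at hC
  refine H hC (fun hC => ?_) (nfal_A21 hx)
  refine H hC (fun hC => ?_) nfal_A20
  refine H hC (fun hC => ?_) (nfal_A19 hx)
  refine H hC (fun hC => ?_) (nfal_A18 hx)
  refine H hC (fun hC => ?_) (nfal_A17 hx)
  refine H hC (fun hC => ?_) (nfal_A16 hx)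
  refine H hC (fun hC => ?_) (nfal_A15 hx)
  refine H hC (fun hC => ?_) (nfal_A14 hx)
  refine H hC (fun hC => ?_) (nfal_A13 hx)
  refine H hC (fun hC => ?_) (nfal_A12 hx)
  refine H hC (fun hC => ?_) (nfal_A11 hx)
  refine H hC (fun hC => ?_) nfal_A10
  refine H hC (fun hC => ?_) nfal_A9
  refine H hC (fun hC => ?_) nfal_A8
  refine H hC (fun hC => ?_) nfal_A7
  refine H hC (fun hC => ?_) nfal_A6
  refine H hC (fun hC => ?_) nfal_A5
  refine H hC (fun hC => ?_) (nfal_A4 hx)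
  refine H hC (fun hC => ?_) (nfal_A3 hx)
  refine H hC (nfal_A1 hx C) (nfal_A2 hx)

end Claim8

/-! ### Counting in the product space `(Fin N → Bool × (V → Bool))` -/

section Counting

variable {V : Type*} [Fintype V] [DecidableEq V]

/-- Fixing one coordinate halves the cube. [folklore] -/
theorem card_filter_apply_eq (x₀ : V) (b : Bool) :
    (univ.filter fun β : V → Bool => β x₀ = b).card = 2 ^ (Fintype.card V - 1) := by
  have hset : (univ.filter fun β : V → Bool => β x₀ = b) =
      Fintype.piFinset fun x => if x = x₀ then ({b} : Finset Bool) else univ := by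
    ext β
    simp only [mem_filter, mem_univ, true_and, Fintype.mem_piFinset]
    constructor
    · intro h x
      split_ifs with hx
      · subst hx; simpa using h
      · exact mem_univ _
    · intro h
      simpa using h x₀
  rw [hset, Fintype.card_piFinset]
  simp only [apply_ite Finset.card, card_singleton, card_univ, Fintype.card_bool]
  rw [prod_ite, prod_const_one, one_mul, prod_const, filter_ne']
  congr 1
  rw [card_erase_of_mem (mem_univ _), card_univ]

/-- An event on `Bool × (V → Bool)` contained in "first coordinate true, or coordinate `x₀` of
the second equals `c`" has probability `≤ 3/4`. [cite: AtseriasMuller2020, Lemma 10 (proof: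
"A literal that mentions u evaluates to 1 under ρ with probability at least 1/4")] -/
theorem four_mul_card_le (E : Finset (Bool × (V → Bool))) (x₀ : V) (c : Bool)
    (hE : ∀ x ∈ E, x.1 = true ∨ x.2 x₀ = c) :
    4 * E.card ≤ 3 * Fintype.card (Bool × (V → Bool)) := by
  classical
  set T : Finset (Bool × (V → Bool)) := univ.filter fun x => x.1 = true ∨ x.2 x₀ = c with hT
  have hET : E ⊆ T := fun x hx => by rw [hT, mem_filter]; exact ⟨mem_univ _, hE x hx⟩
  have hTc : 2 ^ (Fintype.card V - 1) ≤ Tᶜ.card := by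
    rw [← card_filter_apply_eq x₀ (!c)]
    refine card_le_card_of_injOn (fun β => (false, β)) (fun β hβ => ?_) (fun β _ β' _ h => by
      simpa using h)
    rw [mem_coe, mem_filter] at hβ
    rw [mem_coe, mem_compl, hT, mem_filter]
    simp [hβ.2]
  have hX : Fintype.card (Bool × (V → Bool)) = 4 * 2 ^ (Fintype.card V - 1) := by
    rw [Fintype.card_prod, Fintype.card_bool, Fintype.card_fun, Fintype.card_bool]
    have : 0 < Fintype.card V := Fintype.card_pos_iff.2 ⟨x₀⟩
    obtain ⟨k, hk⟩ : ∃ k, Fintype.card V = k + 1 := ⟨_, (Nat.succ_pred_eq_of_pos this).symm⟩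
    rw [hk, pow_succ]; simp; ring
  have hTcard : T.card + Tᶜ.card = Fintype.card (Bool × (V → Bool)) := by
    rw [card_compl]; have := card_le_univ T; omega
  have := card_le_card hET
  omega

variable {N : ℕ}

/-- Cylinder events have product cardinality. [folklore] -/
theorem card_cylinder (M : Finset (Fin N)) (E : Fin N → Finset (Bool × (V → Bool))) :
    (univ.filter fun f : Fin N → Bool × (V → Bool) => ∀ u ∈ M, f u ∈ E u).card =
      (∏ u ∈ M, (E u).card) * Fintype.card (Bool × (V → Bool)) ^ (N - M.card) := by
  have hset : (univ.filter fun f : Fin N → Bool × (V → Bool) => ∀ u ∈ M, f u ∈ E u) =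
      Fintype.piFinset fun u => if u ∈ M then E u else univ := by
    ext f
    simp only [mem_filter, mem_univ, true_and, Fintype.mem_piFinset]
    constructor
    · intro h u
      split_ifs with hu
      · exact h u hu
      · exact mem_univ _
    · intro h u hu
      simpa [hu] using h u
  rw [hset, Fintype.card_piFinset]
  simp only [apply_ite Finset.card, card_univ]
  rw [prod_ite, prod_const]
  congr 2
  · ext u; simp
  · rw [filter_not, card_sdiff_of_subset (by intro u; simp)]
    simp only [card_univ, Fintype.card_fin]
    congr 1
    congr 1; ext u; simp

/-- **The union-bound estimate for one clause**: a cylinder event each of whose `|M|` factors has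
probability `≤ 3/4` has probability `≤ (3/4)^{|M|}`. [cite: AtseriasMuller2020, Lemma 10 (proof:
"the probability that a clause of index-width at least w is not satisfied by ρ is at most
(3/4)^w")] -/
theorem card_cylinder_le (M : Finset (Fin N)) (E : Fin N → Finset (Bool × (V → Bool)))
    (hE : ∀ u ∈ M, 4 * (E u).card ≤ 3 * Fintype.card (Bool × (V → Bool))) :
    4 ^ M.card * (univ.filter fun f : Fin N → Bool × (V → Bool) => ∀ u ∈ M, f u ∈ E u).card ≤
      3 ^ M.card * Fintype.card (Fin N → Bool × (V → Bool)) := by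
  rw [card_cylinder, Fintype.card_fun, Fintype.card_fin]
  set X := Fintype.card (Bool × (V → Bool))
  have h1 : 4 ^ M.card * ∏ u ∈ M, (E u).card ≤ 3 ^ M.card * X ^ M.card := by
    rw [← prod_const (4 : ℕ), ← prod_mul_distrib, ← prod_const (3 : ℕ), ← prod_const X,
      ← prod_mul_distrib]
    exact prod_le_prod' fun u hu => hE u hu
  have hMN : M.card ≤ N := by simpa using card_le_univ M
  calc 4 ^ M.card * ((∏ u ∈ M, (E u).card) * X ^ (N - M.card))
      = (4 ^ M.card * ∏ u ∈ M, (E u).card) * X ^ (N - M.card) := by ring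
    _ ≤ (3 ^ M.card * X ^ M.card) * X ^ (N - M.card) := Nat.mul_le_mul_right _ h1
    _ = 3 ^ M.card * X ^ N := by
        rw [mul_assoc, ← pow_add, Nat.add_sub_cancel' hMN]

/-- The exponential moment of the number of inactive coordinates:
`∑_f 2^{#inactive(f)} = (3 · 2^{|V|})^N`. [folklore] -/
theorem sum_two_pow_card_inactive :
    ∑ f : Fin N → Bool × (V → Bool), 2 ^ (univ.filter fun u => (f u).1 = false).card =
      (3 * Fintype.card (V → Bool)) ^ N := by
  have h1 : ∀ f : Fin N → Bool × (V → Bool),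
      2 ^ (univ.filter fun u => (f u).1 = false).card = ∏ u, (if (f u).1 = false then 2 else 1) := by
    intro f
    rw [prod_ite, prod_const_one, mul_one, prod_const]
  simp_rw [h1]
  rw [← Fintype.prod_sum (fun (_ : Fin N) (x : Bool × (V → Bool)) => if x.1 = false then 2 else 1)]
  rw [prod_const, card_univ, Fintype.card_fin]
  congr 1
  rw [Fintype.sum_prod_type]
  simp only [Fintype.sum_bool]
  simp only [Bool.true_eq_false, ↓reduceIte, sum_const, card_univ, smul_eq_mul, mul_one]
  ring

/-- **The tail estimate**: `#{f : #active(f) ≤ m} · 2^{N-m} ≤ (3 · 2^{|V|})^N` (the exponential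
moment bound replacing the Chernoff bound of the printed proof).
[cite: AtseriasMuller2020, Lemma 10 (proof: "By the Chernoff bound ... |A| < 6nw with probability
at most 2^{-εnw}")] -/
theorem card_tail_mul_le (m : ℕ) :
    (univ.filter fun f : Fin N → Bool × (V → Bool) =>
        (univ.filter fun u => (f u).1 = true).card ≤ m).card * 2 ^ (N - m) ≤
      (3 * Fintype.card (V → Bool)) ^ N := by
  rw [← sum_two_pow_card_inactive, card_eq_sum_ones, sum_mul, one_mul]
  refine (sum_le_sum fun f hf => ?_).trans (sum_le_univ_sum_of_nonneg fun _ => Nat.zero_le _)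
  rw [mem_filter] at hf
  apply Nat.pow_le_pow_right (by norm_num)
  have hsplit : (univ.filter fun u : Fin N => (f u).1 = true).card +
      (univ.filter fun u : Fin N => (f u).1 = false).card = N := by
    have := card_filter_add_card_filter_not (s := (univ : Finset (Fin N)))
      (fun u => (f u).1 = true)
    simp only [card_univ, Fintype.card_fin, Bool.not_eq_true] at this
    exact this
  omega

end Counting

/-! ### The width contradiction for a fixed good frame (Lemma 4 applied to `RREF(F,t)|ρ`) -/

section Width

variable (Φ : Frame)

/-- The line indices mentioned by a set-clause. [cite: AtseriasMuller2020, §4 (index-width)] -/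
def owners (E : Finset (Literal RefVar)) : Finset ℕ := E.image fun l => owner l.1

/-- The side condition `ok`: all literals unassigned by `ρ` and index-width `< wI`.
[cite: AtseriasMuller2020, Lemma 4 (refutations of index-width smaller than w)] -/
def okP (β : RefVar → Bool) (wI : ℕ) (E : Finset (Literal RefVar)) : Prop :=
  (∀ l ∈ E, rho Φ β l.1 = none) ∧ (owners E).card + 1 ≤ wI

/-- The family `P` of assignments `α(p)`, `p` a condition with `|Dom(g)| < wI`.
[cite: AtseriasMuller2020, Lemma 4 (proof: "Let P be the set of conditions p = (g,h) with
|Dom(g)| ≤ w")] -/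
def Ps (wI : ℕ) : Set (RefVar → Option Bool) :=
  {α | ∃ g h, IsCond Φ g h ∧ (dom Φ g).card + 1 ≤ wI ∧ α = alpha Φ g h}

variable {Φ}

/-- The empty condition. [cite: AtseriasMuller2020, Lemma 4 (proof: p₀)] -/
theorem isCond_empty : IsCond Φ (fun _ => none) (fun _ => none) where
  hg := { mem := by simp, len := by simp, blk := by simp, heap := by simp, inj := by simp }
  hh := { mem := by simp, len := by simp, blk := by simp, heap := by simp, inj := by simp }
  sub := by simp
  imgh := by simp
  bdh c hc := by
    obtain ⟨a, ha, -⟩ := mem_bd.1 hc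
    obtain ⟨u, -, hu⟩ := mem_img.1 ha
    simp at hu

/-- The empty map has empty domain. [folklore] -/
theorem dom_empty : dom Φ (fun _ => none) = ∅ := by
  simp [dom]

/-- Axioms of `RREF(F,t)|ρ` are never falsified by `α(p)` (Claim 8, restated for `Falsifies`).
[cite: AtseriasMuller2020, Claim 8] -/
theorem not_falsifies_axiom {g h : PMap} (hx : Ctx Φ g h) (β : RefVar → Bool) :
    ∀ A ∈ restrictFormula (rho Φ β) (clauseSet (RefCNF.rref Φ.X Φ.F Φ.t)),
      ¬ Falsifies (alpha Φ g h) A := by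
  rintro A ⟨Cf, hCf, hns, rfl⟩ hF
  obtain ⟨c, hc, rfl⟩ := mem_clauseSet_iff.1 hCf
  refine nfal_rref (β := β) hx c hc fun l hl => ?_
  have hl' : l ∈ c.toFinset := List.mem_toFinset.2 hl
  unfold mu
  cases hρ : rho Φ β l.1 with
  | none =>
    rw [Option.none_or]
    exact hF l (mem_restrictClause.2 ⟨hl', hρ⟩)
  | some v =>
    rw [Option.some_or]
    have hv : v ≠ l.2 := fun h => hns ⟨l, hl', by rw [hρ, h]⟩
    cases v <;> cases h2 : l.2 <;> simp_all

/-- Restricting a condition to the owners of an `ok` clause it falsifies (the step `p''` of the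
printed proof). [cite: AtseriasMuller2020, Lemma 4 (proof: "Let p'' be the restriction of p' to
the indices mentioned in C")] -/
theorem exists_shrink {g₂ h₂ : PMap} (hc₂ : IsCond Φ g₂ h₂) {β : RefVar → Bool} {wI : ℕ}
    {D : Finset (Literal RefVar)} (hD : okP Φ β wI D) (hF : Falsifies (alpha Φ g₂ h₂) D) :
    ∃ α'' ∈ Ps Φ wI, Falsifies α'' D := by
  set I := owners D
  have hc₃ := hc₂.restrict I
  refine ⟨alpha Φ (restrictG I g₂) (restrictH Φ I g₂ h₂), ⟨_, _, hc₃, ?_, rfl⟩, fun l hl => ?_⟩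
  · exact (Nat.add_le_add_right (card_dom_restrictG_le I g₂) 1).trans hD.2
  · have h2 := hF l hl
    have hown : owner l.1 ∈ I := mem_image_of_mem _ hl
    have hne : alpha Φ (restrictG I g₂) (restrictH Φ I g₂ h₂) l.1 ≠ none := by
      rw [Ne, alpha_eq_none_iff]
      intro h0
      rw [restrictG, if_pos hown] at h0
      have := (alpha_eq_none_iff (Φ := Φ) (g := g₂) (h := h₂) (x := l.1)).2 h0
      rw [h2] at this
      simp at this
    obtain ⟨v, hv⟩ := Option.ne_none_iff_exists'.1 hne
    have := alpha_mono hc₃ hc₂ (fun u a hu => (restrictG_eq_some_iff.1 hu).2)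
      (fun u a hu => (restrictH_eq_some_iff.1 hu).1) _ _ hv
    rw [h2] at this
    cases this
    exact hv

/-- The extension property of the adversary lemma for `P` (Claims 6 and 7).
[cite: AtseriasMuller2020, Lemma 4 (proof, final paragraph)] -/
theorem hext_Ps (hG : Φ.Good) {wI : ℕ} (hwB : Φ.wB = 3 * wI) (β : RefVar → Bool) :
    ∀ α ∈ Ps Φ wI, ∀ C, okP Φ β wI C → ∀ l ∈ C, ∃ α', PExtends α α' ∧ α' l.1 ≠ none ∧
      ∀ D, okP Φ β wI D → Falsifies α' D → ∃ α'' ∈ Ps Φ wI, Falsifies α'' D := by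
  rintro α ⟨g, h, hc, hcard, rfl⟩ C hC l hl
  have hu : owner l.1 ∈ Φ.A := Frame.actv_eq_true_iff.1 (rho_eq_none_imp β (hC.1 l hl))
  by_cases hgu : g (owner l.1) = none
  · have hroom : 3 * ((dom Φ g).card + 1) ≤ Φ.wB := by rw [hwB]; exact Nat.mul_le_mul_left 3 hcard
    obtain ⟨g₂, h₂, hc₂, hgg, hhh, hsome, -⟩ := hc.exists_extend hG hroom hu hgu
    refine ⟨alpha Φ g₂ h₂, alpha_mono hc hc₂ hgg hhh, ?_, fun D hD hF => exists_shrink hc₂ hD hF⟩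
    rw [Ne, alpha_eq_none_iff]
    intro h0
    rw [h0] at hsome
    simp at hsome
  · refine ⟨alpha Φ g h, fun _ _ h => h, ?_, fun D hD hF => exists_shrink hc hD hF⟩
    rw [Ne, alpha_eq_none_iff]
    exact hgu

/-- `mapCNF decode` undoes the numbering `toNat`. [folklore] -/
theorem mapCNF_decode_toNat (φ : CNF RefVar) : mapCNF RefVar.decode (RefCNF.toNat φ) = φ := by
  unfold mapCNF RefCNF.toNat
  rw [List.map_map]
  conv_rhs => rw [← List.map_id φ]
  refine List.map_congr_left fun c _ => ?_
  rw [Function.comp_apply, List.map_map]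
  conv_rhs => rw [← List.map_id c]
  refine List.map_congr_left fun l _ => ?_
  simp

/-- **Lemma 4 of [Atserias–Müller 2020] in the form needed** (index-width lower bound for the
restricted refutation): for a good frame whose last line is active, every refutation of
`RREF(F,t)` has a line which, read over `RefVar` and restricted by `ρ`, is not satisfied and
mentions at least `wI` line indices (`wB = 3 wI`).
[cite: AtseriasMuller2020, Lemma 4 with Lemma 10 (proof: "Π|ρ is a Resolution refutation of
REF(F,A) ... this contradicts Lemma 4")] -/
theorem exists_fat_line (hG : Φ.Good) (hlast : Φ.t - 1 ∈ Φ.A) {wI : ℕ} (hwI : 1 ≤ wI)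
    (hwB : Φ.wB = 3 * wI) (hX : Φ.X = RefCNF.sortedVars Φ.F) (β : RefVar → Bool)
    {π : List (ResLine ℕ)} (hπ : IsResRefutation (rrefCNF Φ.F Φ.t) π) :
    ∃ l ∈ π, ¬ SatisfiedBy (rho Φ β) (mapClause RefVar.decode l.clause) ∧
      wI ≤ (owners (restrictClause (rho Φ β) (mapClause RefVar.decode l.clause))).card := by
  by_contra hall
  simp only [not_exists, not_and, not_le] at hall
  have hok : ∀ l ∈ π, ¬ SatisfiedBy (rho Φ β) (mapClause RefVar.decode l.clause) →
      okP Φ β wI (restrictClause (rho Φ β) (mapClause RefVar.decode l.clause)) :=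
    fun l hl hns => ⟨fun l' hl' => (mem_restrictClause.1 hl').2, hall l hl hns⟩
  have hder := iwDerivable_restrict_map hπ RefVar.decode (rho Φ β) hok
  rw [rrefCNF_eq, mapCNF_decode_toNat, ← hX] at hder
  have h0 : alpha Φ (fun _ => none) (fun _ => none) ∈ Ps Φ wI :=
    ⟨_, _, isCond_empty, by rw [dom_empty]; simpa using hwI, rfl⟩
  refine hder.not_falsifies (Ps := Ps Φ wI) ?_ (hext_Ps hG hwB β) _ h0 (fun l hl => by simp at hl)
  rintro α ⟨g, h, hc, -, rfl⟩
  exact not_falsifies_axiom ⟨hG, hc, hlast⟩ β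

end Width

/-! ### The probability space of restrictions and the bad events -/

section Events

/-- Is the variable an activity variable `P[u]`? [folklore] -/
def isP : RefVar → Bool
  | .P _ => true
  | _ => false

/-- Activity variables are always assigned by `ρ`. [folklore] -/
theorem isP_eq_false_of_rho_eq_none {Φ : Frame} {β : RefVar → Bool} {x : RefVar}
    (hx : rho Φ β x = none) : isP x = false := by
  cases x with
  | P u => simp [rho] at hx
  | _ => rfl

/-- Non-`P` variables of inactive lines get their random value. [cite: AtseriasMuller2020,
Lemma 10 (proof: step 4 of the random restriction)] -/
theorem rho_of_inactive {Φ : Frame} {β : RefVar → Bool} {x : RefVar}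
    (hx : Φ.actv (owner x) = false) (hP : isP x = false) : rho Φ β x = some (β x) := by
  cases x with
  | P u => simp [isP] at hP
  | D u i b => simp only [owner] at hx; simp [rho, hx]
  | V u i => simp only [owner] at hx; simp [rho, hx]
  | I u j => simp only [owner] at hx; simp [rho, hx]
  | L u v => simp only [owner] at hx; cases v <;> simp [rho, hx]
  | R u v => simp only [owner] at hx; cases v <;> simp [rho, hx]

variable (N : ℕ) (VarsR : Finset RefVar)

/-- Activity bits read from a sample point: coordinate `u < N` carries the bit of line `u`, the
last line `N` is always active, nothing beyond. [cite: AtseriasMuller2020, Lemma 10 (proof: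
step 1 of the random restriction, with (iii) P[t] ↦ 1 built in)] -/
def actOf {γ : Type*} (f : Fin N → Bool × γ) (u : ℕ) : Bool :=
  if h : u < N then (f ⟨u, h⟩).1 else decide (u = N)

/-- Extending an assignment of the relevant variables by `false`. [folklore] -/
def extb (β : {x // x ∈ VarsR} → Bool) (x : RefVar) : Bool :=
  if h : x ∈ VarsR then β ⟨x, h⟩ else false

/-- The random values read from a sample point: the variable `x` of line `u < N` gets the value
that coordinate `u` assigns to it. [cite: AtseriasMuller2020, Lemma 10 (proof: step 4)] -/
def betaOf (f : Fin N → Bool × ({x // x ∈ VarsR} → Bool)) (x : RefVar) : Bool :=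
  if h : owner x < N then extb VarsR (f ⟨owner x, h⟩).2 x else false

/-- The frame determined by a sample point. [cite: AtseriasMuller2020, Lemma 10 (proof)] -/
def frameOf (n K wB : ℕ) (X : List ℕ) (F : CNF ℕ) {γ : Type*} (f : Fin N → Bool × γ) : Frame where
  n := n
  t := N + 1
  act := actOf N f
  K := K
  wB := wB
  X := X
  F := F

variable {N VarsR}

/-- The activity bit of a coordinate. [folklore] -/
theorem actOf_val {γ : Type*} (f : Fin N → Bool × γ) (u : Fin N) : actOf N f u.val = (f u).1 := by
  simp [actOf]

/-- The last line is active. [folklore] -/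
theorem actOf_last {γ : Type*} (f : Fin N → Bool × γ) : actOf N f N = true := by
  simp [actOf]

section FrameOf

variable {n K wB : ℕ} {X : List ℕ} {F : CNF ℕ} {γ : Type*} (f : Fin N → Bool × γ)

/-- The last line of the frame of a sample point is active. [folklore] -/
theorem frameOf_last_mem : N ∈ (frameOf N n K wB X F f).A := by
  rw [Frame.mem_A]
  exact ⟨Nat.lt_succ_self _, actOf_last f⟩

/-- Activity in the frame of a sample point. [folklore] -/
theorem frameOf_actv_val (u : Fin N) : (frameOf N n K wB X F f).actv u.val = (f u).1 := by
  simp [Frame.actv, frameOf, actOf]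

/-- The number of active lines of the frame of a sample point. [folklore] -/
theorem frameOf_card_A :
    (frameOf N n K wB X F f).A.card = (univ.filter fun u : Fin N => (f u).1 = true).card + 1 := by
  have hA : (frameOf N n K wB X F f).A =
      insert N ((univ.filter fun u : Fin N => (f u).1 = true).image Fin.val) := by
    ext u
    rw [Frame.mem_A, mem_insert, mem_image]
    simp only [frameOf]
    constructor
    · rintro ⟨hu, hact⟩
      rcases Nat.lt_succ_iff_lt_or_eq.1 hu with hu | rfl
      · right
        refine ⟨⟨u, hu⟩, mem_filter.2 ⟨mem_univ _, ?_⟩, rfl⟩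
        rwa [← actOf_val f ⟨u, hu⟩]
      · left; rfl
    · rintro (rfl | ⟨v, hv, rfl⟩)
      · exact ⟨Nat.lt_succ_self _, actOf_last f⟩
      · exact ⟨v.2.trans (Nat.lt_succ_self _), by rw [actOf_val]; exact (mem_filter.1 hv).2⟩
  rw [hA, card_insert_of_notMem, card_image_of_injective _ Fin.val_injective]
  simp only [mem_image, mem_filter, mem_univ, true_and, not_exists, not_and]
  intro v _ hv
  exact absurd hv (ne_of_lt v.2)

end FrameOf

/-- The literals of `C` on non-`P` variables of line `u`. [folklore] -/
def ownedLits (C : Finset (Literal RefVar)) (u : ℕ) : Finset (Literal RefVar) :=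
  C.filter fun l => owner l.1 = u ∧ isP l.1 = false

variable (N) in
/-- The coordinates `u < N` mentioned by `C` through non-`P` variables.
[cite: AtseriasMuller2020, §4 (indices mentioned by a clause)] -/
def Mset (C : Finset (Literal RefVar)) : Finset (Fin N) :=
  univ.filter fun u => (ownedLits C u.val).Nonempty

variable (VarsR) in
/-- The bad event at coordinate `u`: line `u` is active, or all literals of `C` on line `u` are
falsified by the random values. [cite: AtseriasMuller2020, Lemma 10 (proof: "a literal that
mentions u evaluates to 1 under ρ ... in the event that P[u] is mapped to 0 and the right value
is chosen")] -/
def Eset (C : Finset (Literal RefVar)) (u : ℕ) : Finset (Bool × ({x // x ∈ VarsR} → Bool)) :=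
  univ.filter fun x => x.1 = true ∨ ∀ l ∈ ownedLits C u, extb VarsR x.2 l.1 = !l.2

variable (N VarsR) in
/-- The bad event of the clause `C`: every mentioned coordinate is bad.
[cite: AtseriasMuller2020, Lemma 10 (proof: "a clause of index-width at least w is not
satisfied by ρ")] -/
def BadSet (C : Finset (Literal RefVar)) : Finset (Fin N → Bool × ({x // x ∈ VarsR} → Bool)) :=
  univ.filter fun f => ∀ u ∈ Mset N C, f u ∈ Eset VarsR C u.val

/-- **The link**: if, under the restriction read from the sample point `f`, the clause `C` is not
satisfied and its restriction mentions `≥ wI` line indices, then `f` lies in the bad event of `C`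
and `C` mentions `≥ wI - 1` coordinates. [cite: AtseriasMuller2020, Lemma 10 (proof, (i))] -/
theorem link {n K wB : ℕ} {X : List ℕ} {F : CNF ℕ} (f : Fin N → Bool × ({x // x ∈ VarsR} → Bool))
    (C : Finset (Literal RefVar))
    (hns : ¬ SatisfiedBy (rho (frameOf N n K wB X F f) (betaOf N VarsR f)) C) {wI : ℕ}
    (hfat : wI ≤ (owners (restrictClause (rho (frameOf N n K wB X F f) (betaOf N VarsR f)) C)).card) :
    f ∈ BadSet N VarsR C ∧ wI ≤ (Mset N C).card + 1 := by
  set Φ := frameOf N n K wB X F f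
  set β := betaOf N VarsR f
  constructor
  · rw [BadSet, mem_filter]
    refine ⟨mem_univ _, fun u _ => ?_⟩
    rw [Eset, mem_filter]
    refine ⟨mem_univ _, ?_⟩
    cases hfu : (f u).1
    · right
      intro l hl
      obtain ⟨hlC, hown, hP⟩ := by simpa [ownedLits] using hl
      have hact : Φ.actv (owner l.1) = false := by
        rw [hown, frameOf_actv_val, hfu]
      have hρ : rho Φ β l.1 = some (β l.1) := rho_of_inactive hact hP
      have hβ : β l.1 = extb VarsR (f u).2 l.1 := by
        show betaOf N VarsR f l.1 = _
        unfold betaOf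
        have hlt : owner l.1 < N := by rw [hown]; exact u.2
        rw [dif_pos hlt]
        congr
      have hne : β l.1 ≠ l.2 := fun h => hns ⟨l, hlC, by rw [hρ, h]⟩
      rw [← hβ]
      cases hb : β l.1 <;> cases h2 : l.2 <;> simp_all
    · left; rfl
  · set O := owners (restrictClause (rho Φ β) C)
    have hsub : O.erase N ⊆ (Mset N C).image Fin.val := by
      intro u hu
      obtain ⟨huN, huO⟩ := mem_erase.1 hu
      obtain ⟨l, hl, hlo⟩ := mem_image.1 huO
      obtain ⟨hlC, hρ⟩ := mem_restrictClause.1 hl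
      have hact := rho_eq_none_imp β hρ
      rw [hlo] at hact
      have hut : u < N + 1 := (Φ.mem_A.1 (Frame.actv_eq_true_iff.1 hact)).1
      have huN' : u < N := by omega
      refine mem_image.2 ⟨⟨u, huN'⟩, mem_filter.2 ⟨mem_univ _, ⟨l, ?_⟩⟩, rfl⟩
      simp only [ownedLits, mem_filter]
      exact ⟨hlC, hlo, isP_eq_false_of_rho_eq_none hρ⟩
    have h1 := card_le_card hsub
    have h2 := pred_card_le_card_erase (s := O) (a := N)
    have h3 : ((Mset N C).image Fin.val).card ≤ (Mset N C).card := card_image_le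
    omega

/-- The bad event of a clause of the refutation has probability `≤ (3/4)^{|M|}`.
[cite: AtseriasMuller2020, Lemma 10 (proof: "(3/4)^w")] -/
theorem card_badSet_le (C : Finset (Literal RefVar)) (hV : ∀ l ∈ C, l.1 ∈ VarsR) :
    4 ^ (Mset N C).card * (BadSet N VarsR C).card ≤
      3 ^ (Mset N C).card * Fintype.card (Fin N → Bool × ({x // x ∈ VarsR} → Bool)) := by
  refine card_cylinder_le (Mset N C) (fun u => Eset VarsR C u.val) fun u hu => ?_
  obtain ⟨l₀, hl₀⟩ := (mem_filter.1 hu).2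
  have hl₀C : l₀ ∈ C := (mem_filter.1 hl₀).1
  refine four_mul_card_le _ ⟨l₀.1, hV l₀ hl₀C⟩ (!l₀.2) fun x hx => ?_
  rcases (mem_filter.1 hx).2 with h | h
  · exact Or.inl h
  · right
    have := h l₀ hl₀
    simpa [extb, hV l₀ hl₀C] using this

/-- **The probabilistic existence statement** (union bound + tail bound, as counting): if
`2^{m+1} 3^N < 4^N` and `2 ℓ 3^{m₀} < 4^{m₀}`, some sample point has more than `m` active
coordinates and avoids the bad event of every clause mentioning `≥ m₀` coordinates.
[cite: AtseriasMuller2020, Lemma 10 (proof: "there exists a restriction ρ ... such that (i),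
(ii), (iii)")] -/
theorem exists_good_point (m m₀ : ℕ) (hmN : m ≤ N) (Cs : List (Finset (Literal RefVar)))
    (hV : ∀ C ∈ Cs, ∀ l ∈ C, l.1 ∈ VarsR) (htail : 2 ^ (m + 1) * 3 ^ N < 4 ^ N)
    (hunion : 2 * Cs.length * 3 ^ m₀ < 4 ^ m₀) :
    ∃ f : Fin N → Bool × ({x // x ∈ VarsR} → Bool),
      m < (univ.filter fun u => (f u).1 = true).card ∧
      ∀ C ∈ Cs, m₀ ≤ (Mset N C).card → f ∉ BadSet N VarsR C := by
  classical
  set Ω := Fintype.card (Fin N → Bool × ({x // x ∈ VarsR} → Bool)) with hΩ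
  set hV' := Fintype.card ({x // x ∈ VarsR} → Bool)
  have hXc : Fintype.card (Bool × ({x // x ∈ VarsR} → Bool)) = 2 * hV' := by
    rw [Fintype.card_prod, Fintype.card_bool]
  have hΩeq : Ω = 2 ^ N * hV' ^ N := by
    rw [hΩ, Fintype.card_fun, Fintype.card_fin, hXc, mul_pow]
  have hVpos : 0 < hV' := Fintype.card_pos
  have hΩpos : 0 < Ω := by rw [hΩeq]; positivity
  -- the tail event
  set T := (univ.filter fun f : Fin N → Bool × ({x // x ∈ VarsR} → Bool) =>
    (univ.filter fun u => (f u).1 = true).card ≤ m) with hT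
  have hTle : T.card * 2 ^ (N - m) ≤ (3 * hV') ^ N := card_tail_mul_le m
  have hT2 : 2 * T.card < Ω := by
    have h1 : 2 * 3 ^ N < 2 ^ N * 2 ^ (N - m) := by
      have : 2 ^ N * 2 ^ (N - m) * 2 ^ m = 4 ^ N := by
        rw [mul_assoc, ← pow_add, Nat.sub_add_cancel hmN, ← mul_pow]
        norm_num
      have h4 : 2 ^ (m + 1) * 3 ^ N = 2 * 3 ^ N * 2 ^ m := by ring
      rw [h4, ← this] at htail
      exact Nat.lt_of_mul_lt_mul_right htail
    have h2 : 2 * T.card * 2 ^ (N - m) < Ω * 2 ^ (N - m) := by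
      calc 2 * T.card * 2 ^ (N - m) = 2 * (T.card * 2 ^ (N - m)) := by ring
        _ ≤ 2 * (3 * hV') ^ N := Nat.mul_le_mul_left 2 hTle
        _ = 2 * 3 ^ N * hV' ^ N := by rw [mul_pow]; ring
        _ < 2 ^ N * 2 ^ (N - m) * hV' ^ N := Nat.mul_lt_mul_of_lt_of_le h1 le_rfl (by positivity)
        _ = Ω * 2 ^ (N - m) := by rw [hΩeq]; ring
    exact Nat.lt_of_mul_lt_mul_right h2
  -- the union of the bad events of the fat clauses
  set B := ((Cs.toFinset).filter fun C => m₀ ≤ (Mset N C).card).biUnion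
    fun C => BadSet N VarsR C with hB
  have hB2 : 2 * B.card < Ω := by
    have hle : 4 ^ m₀ * B.card ≤ Cs.length * (3 ^ m₀ * Ω) := by
      calc 4 ^ m₀ * B.card
          ≤ 4 ^ m₀ * ∑ C ∈ (Cs.toFinset).filter fun C => m₀ ≤ (Mset N C).card,
              (BadSet N VarsR C).card := Nat.mul_le_mul_left _ card_biUnion_le
        _ = ∑ C ∈ (Cs.toFinset).filter fun C => m₀ ≤ (Mset N C).card,
              4 ^ m₀ * (BadSet N VarsR C).card := mul_sum _ _ _
        _ ≤ ∑ C ∈ (Cs.toFinset).filter fun C => m₀ ≤ (Mset N C).card, 3 ^ m₀ * Ω := by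
            refine sum_le_sum fun C hC => ?_
            obtain ⟨hCs, hm₀⟩ := mem_filter.1 hC
            have hkey := card_badSet_le (N := N) C (hV C (List.mem_toFinset.1 hCs))
            -- downgrade the exponent from `|M|` to `m₀`
            obtain ⟨d, hd⟩ : ∃ d, (Mset N C).card = m₀ + d := ⟨_, (Nat.add_sub_cancel' hm₀).symm⟩
            rw [hd, pow_add, pow_add] at hkey
            have h3 : 3 ^ m₀ * 3 ^ d * Ω ≤ 3 ^ m₀ * 4 ^ d * Ω :=
              Nat.mul_le_mul_right _ (Nat.mul_le_mul_left _ (Nat.pow_le_pow_left (by norm_num) _))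
            have h4 : 4 ^ m₀ * (BadSet N VarsR C).card * 4 ^ d ≤ 3 ^ m₀ * Ω * 4 ^ d := by
              calc 4 ^ m₀ * (BadSet N VarsR C).card * 4 ^ d
                  = 4 ^ m₀ * 4 ^ d * (BadSet N VarsR C).card := by ring
                _ ≤ 3 ^ m₀ * 3 ^ d * Ω := hkey
                _ ≤ 3 ^ m₀ * 4 ^ d * Ω := h3
                _ = 3 ^ m₀ * Ω * 4 ^ d := by ring
            exact Nat.le_of_mul_le_mul_right h4 (by positivity)
        _ = ((Cs.toFinset).filter fun C => m₀ ≤ (Mset N C).card).card * (3 ^ m₀ * Ω) := by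
            rw [sum_const, smul_eq_mul]
        _ ≤ Cs.length * (3 ^ m₀ * Ω) :=
            Nat.mul_le_mul_right _ ((card_filter_le _ _).trans (List.toFinset_card_le _))
    have h2 : 2 * B.card * 4 ^ m₀ < Ω * 4 ^ m₀ := by
      calc 2 * B.card * 4 ^ m₀ = 2 * (4 ^ m₀ * B.card) := by ring
        _ ≤ 2 * (Cs.length * (3 ^ m₀ * Ω)) := Nat.mul_le_mul_left 2 hle
        _ = (2 * Cs.length * 3 ^ m₀) * Ω := by ring
        _ < 4 ^ m₀ * Ω := Nat.mul_lt_mul_of_lt_of_le hunion le_rfl hΩpos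
        _ = Ω * 4 ^ m₀ := by ring
    exact Nat.lt_of_mul_lt_mul_right h2
  -- a point outside both
  have hcard : (T ∪ B).card < (univ : Finset (Fin N → Bool × ({x // x ∈ VarsR} → Bool))).card := by
    rw [card_univ, ← hΩ]
    have := card_union_le T B
    omega
  obtain ⟨f, -, hf⟩ := exists_mem_notMem_of_card_lt_card hcard
  rw [mem_union, not_or] at hf
  refine ⟨f, ?_, fun C hC hm₀ hfB => hf.2 ?_⟩
  · by_contra hle
    exact hf.1 (mem_filter.2 ⟨mem_univ _, not_lt.1 hle⟩)
  · rw [hB, mem_biUnion]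
    exact ⟨C, mem_filter.2 ⟨List.mem_toFinset.2 hC, hm₀⟩, hfB⟩

end Events

/-! ### Arithmetic of the constants -/

section Arith

/-- From the real bound `ℓ ≤ 2^{2w/5}` to `ℓ^5 ≤ 4^w`. [folklore] -/
theorem pow_five_le_of_le_rpow {ℓ w : ℕ} (h : (ℓ : ℝ) ≤ (2 : ℝ) ^ ((2 : ℝ) * w / 5)) :
    ℓ ^ 5 ≤ 4 ^ w := by
  have h0 : (0 : ℝ) ≤ ℓ := Nat.cast_nonneg _
  have h1 : ((ℓ : ℝ)) ^ (5 : ℕ) ≤ ((2 : ℝ) ^ ((2 : ℝ) * w / 5)) ^ (5 : ℕ) := pow_le_pow_left₀ h0 h 5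
  have h2 : ((2 : ℝ) ^ ((2 : ℝ) * w / 5)) ^ (5 : ℕ) = (4 : ℝ) ^ w := by
    rw [← Real.rpow_natCast, ← Real.rpow_mul (by norm_num)]
    have : (2 : ℝ) * w / 5 * ((5 : ℕ) : ℝ) = ((2 * w : ℕ) : ℝ) := by push_cast; ring
    rw [this, Real.rpow_natCast, pow_mul]
    norm_num
  rw [h2] at h1
  exact_mod_cast h1

/-- The union bound beats `ℓ ≤ 2^{2w/5}`: `2ℓ·3^{w + ⌊w/4⌋} < 4^{w + ⌊w/4⌋}`. [folklore] -/
theorem union_arith {ℓ w : ℕ} (hℓ : ℓ ^ 5 ≤ 4 ^ w) (hw : 20 ≤ w) :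
    2 * ℓ * 3 ^ (w + w / 4) < 4 ^ (w + w / 4) := by
  set a := w / 4 with ha
  have ha3 : 3 ≤ a := by omega
  have e3 : (3 ^ (w + a)) ^ 5 = 243 ^ (w + a) := by rw [← pow_mul, mul_comm, pow_mul]; norm_num
  have e4 : (4 ^ (w + a)) ^ 5 = 1024 ^ (w + a) := by rw [← pow_mul, mul_comm, pow_mul]; norm_num
  have h32 : 32 * 243 ^ a < 1024 ^ a := by
    have h64 : 64 * 243 ^ a ≤ 1024 ^ a := by
      calc 64 * 243 ^ a ≤ 4 ^ a * 256 ^ a := by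
            refine Nat.mul_le_mul ?_ (Nat.pow_le_pow_left (by norm_num) a)
            calc (64 : ℕ) = 4 ^ 3 := by norm_num
              _ ≤ 4 ^ a := Nat.pow_le_pow_right (by norm_num) ha3
        _ = 1024 ^ a := by rw [← mul_pow]; norm_num
    have : 0 < 243 ^ a := by positivity
    omega
  have key : (2 * ℓ * 3 ^ (w + a)) ^ 5 < (4 ^ (w + a)) ^ 5 := by
    calc (2 * ℓ * 3 ^ (w + a)) ^ 5 = 32 * ℓ ^ 5 * 243 ^ (w + a) := by
          rw [mul_pow, mul_pow, e3]; norm_num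
      _ ≤ 32 * 4 ^ w * 243 ^ (w + a) :=
          Nat.mul_le_mul_right _ (Nat.mul_le_mul_left _ hℓ)
      _ = 972 ^ w * (32 * 243 ^ a) := by
          rw [pow_add, show (972 : ℕ) = 4 * 243 from rfl, mul_pow]; ring
      _ < 1024 ^ w * 1024 ^ a :=
          Nat.mul_lt_mul_of_le_of_lt (Nat.pow_le_pow_left (by norm_num) w) h32 (by positivity)
      _ = (4 ^ (w + a)) ^ 5 := by rw [e4, pow_add]
  exact lt_of_pow_lt_pow_left₀ 5 (Nat.zero_le _) key

/-- The tail bound: `4 · 2^{5q} · 3^{13q} ≤ 4^{13q}` for `q ≥ 6`. [folklore] -/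
theorem tail_arith {q : ℕ} (hq : 6 ≤ q) : 4 * (2 ^ (5 * q) * 3 ^ (13 * q)) ≤ 4 ^ (13 * q) := by
  have e : 2 ^ (5 * q) * 3 ^ (13 * q) = 51018336 ^ q := by
    rw [pow_mul, pow_mul, ← mul_pow]; norm_num
  have e4 : 4 ^ (13 * q) = 67108864 ^ q := by rw [pow_mul]; norm_num
  rw [e, e4]
  obtain ⟨r, rfl⟩ : ∃ r, q = 6 + r := ⟨q - 6, by omega⟩
  rw [pow_add, pow_add]
  calc 4 * (51018336 ^ 6 * 51018336 ^ r) = (4 * 51018336 ^ 6) * 51018336 ^ r := by ring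
    _ ≤ 67108864 ^ 6 * 67108864 ^ r :=
        Nat.mul_le_mul (by norm_num) (Nat.pow_le_pow_left (by norm_num) r)

/-- The blocks fit: `3(w + ⌊w/4⌋ + 1)(n+2) ≤ 5nw` for `n, w ≥ 20`. [folklore] -/
theorem fit_arith {n w : ℕ} (hn : 20 ≤ n) (hw : 20 ≤ w) :
    3 * (w + w / 4 + 1) * (n + 2) ≤ 5 * (n * w) := by
  set a := w / 4 with ha
  have h4 : 4 * a ≤ w := by omega
  nlinarith [Nat.mul_le_mul hn hw, Nat.mul_le_mul_right w hn, Nat.mul_le_mul_left n hw,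
    Nat.mul_le_mul_left n h4]

end Arith

/-! ### The theorem -/

/-- **[Atserias–Müller 2020, Lemma 10]** (discharge of the named fact `rrefCNF_lowerBound`):
there is `n₀` (here `20`) such that for `n ≥ n₀`, `20 ≤ w`, `13nw ≤ 2^n` and every unsatisfiable
CNF `F` with `n` variables, every Resolution refutation of `RREF(F, 13nw)` has length `> 2^{2w/5}`.
Proof: the random restriction of the printed proof, as a counting argument over the sample points
`f : Fin (13nw-1) → Bool × (Vars → Bool)` (`exists_good_point`), followed by the forcing argument
of Lemma 4 on the restricted refutation (`exists_fat_line`); see the module docstring for the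
(inessential) changes of constants. [cite: AtseriasMuller2020, Lemma 10] -/
theorem rrefCNF_lowerBound_holds' :
    ∃ n₀ : ℕ, ∀ (n w : ℕ) (F : CNF ℕ), n₀ ≤ n → 20 ≤ w → 13 * n * w ≤ 2 ^ n →
    (CNF.vars F).card = n → (∀ C ∈ F.clauseFinsets, IsNonTaut C) → ¬ F.Satisfiable →
      ∀ π : List (ResLine ℕ), IsResRefutation (rrefCNF F (13 * n * w)) π →
        (2 : ℝ) ^ ((2 : ℝ) * w / 5) < π.length := by
  refine ⟨20, fun n w F hn hw hnw hcard _ hunsat π hπ => ?_⟩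
  by_contra hlen
  have hℓ : π.length ^ 5 ≤ 4 ^ w := pow_five_le_of_le_rpow (not_lt.1 hlen)
  -- parameters
  set q := n * w with hq
  have hq1 : 400 ≤ q := Nat.mul_le_mul hn hw
  have h13 : 13 * n * w = 13 * q := by rw [hq, Nat.mul_assoc]
  set N := 13 * q - 1 with hN
  have htN : 13 * n * w = N + 1 := by omega
  set a := w / 4 with ha
  set wI := w + a + 1 with hwI
  set wB := 3 * wI with hwB
  set K := Nat.log 2 (wB - 1) with hK
  have hK1 : 2 ^ K ≤ wB - 1 := Nat.pow_log_le_self 2 (by omega)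
  have hK2 : wB - 1 < 2 ^ (K + 1) := Nat.lt_pow_succ_log_self one_lt_two _
  set X := RefCNF.sortedVars F with hX
  -- the lines over `RefVar` and their variables
  set Cs := π.map fun l => mapClause RefVar.decode l.clause with hCs
  set VarsR := Cs.toFinset.biUnion clauseVars with hVarsR
  have hV : ∀ C ∈ Cs, ∀ l ∈ C, l.1 ∈ VarsR := fun C hC l hl =>
    mem_biUnion.2 ⟨C, List.mem_toFinset.2 hC, mem_clauseVars_iff.2 ⟨l, hl, rfl⟩⟩
  -- the good sample point
  have htail : 2 ^ (5 * q - 1 + 1) * 3 ^ N < 4 ^ N := by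
    have h1 := tail_arith (q := q) (by omega)
    have e1 : 5 * q - 1 + 1 = 5 * q := by omega
    have e2 : 13 * q = N + 1 := by omega
    rw [e2, pow_succ, pow_succ] at h1
    rw [e1]
    have : 2 ^ (5 * q) * 3 ^ N * 3 ≤ 4 ^ N := by nlinarith [h1]
    have hpos : 0 < 2 ^ (5 * q) * 3 ^ N := by positivity
    omega
  have hunion : 2 * Cs.length * 3 ^ (w + a) < 4 ^ (w + a) := by
    rw [hCs, List.length_map]
    exact union_arith hℓ hw
  obtain ⟨f, hfact, hfbad⟩ :=
    exists_good_point (N := N) (VarsR := VarsR) (5 * q - 1) (w + a) (by omega) Cs hV htail hunion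
  -- the frame of the sample point is good
  set Φ := frameOf N n K wB X F f with hΦ
  have hG : Φ.Good :=
    { K_lt := by
        by_contra hKn
        have h1 : 2 ^ n ≤ 2 ^ K := Nat.pow_le_pow_right (by norm_num) (not_lt.1 hKn)
        have h2 : w ≤ q := by rw [hq]; exact Nat.le_mul_of_pos_left w (by omega)
        omega
      wB_pos := by show 0 < wB; omega
      wB_le := by show wB ≤ 2 ^ (K + 1); omega
      fit := by
        show 2 ^ (K + 1) - 1 + wB * (n - K) ≤ (frameOf N n K wB X F f).A.card
        rw [frameOf_card_A]
        have h1 : 2 ^ (K + 1) = 2 * 2 ^ K := by rw [pow_succ, mul_comm]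
        have h2 : wB * (n - K) ≤ wB * n := Nat.mul_le_mul_left _ (Nat.sub_le _ _)
        have h3 := fit_arith hn hw
        have h4 : 3 * (w + w / 4 + 1) * (n + 2) = wB * n + 2 * wB := by rw [hwB, hwI, ha]; ring
        omega
      unsat := hunsat
      mem_X := by
        intro c hc l hl
        show l.1 ∈ RefCNF.sortedVars F
        rw [RefCNF.mem_sortedVars]
        simp only [CNF.vars, List.mem_toFinset, List.mem_map, List.mem_flatten]
        exact ⟨l, ⟨c, hc, hl⟩, rfl⟩
      length_X := by
        show (RefCNF.sortedVars F).length = n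
        rw [RefCNF.length_sortedVars, hcard] }
  have hlast : Φ.t - 1 ∈ Φ.A := by
    show N + 1 - 1 ∈ (frameOf N n K wB X F f).A
    rw [Nat.add_sub_cancel]
    exact frameOf_last_mem f
  rw [htN] at hπ
  obtain ⟨l, hl, hns, hfat⟩ :=
    exists_fat_line (Φ := Φ) hG hlast (wI := wI) (by omega) rfl rfl (betaOf N VarsR f) hπ
  obtain ⟨hbad, hM⟩ := link f _ hns hfat
  exact hfbad _ (List.mem_map.2 ⟨l, hl, rfl⟩) (by omega) hbad

end AtseriasMuller

/-- **[Atserias–Müller 2020, Lemma 10]**, the lower bound for the relativized refutation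
statement: discharge of the named fact `rrefCNF_lowerBound` of `RefutationCNF.lean`.
[cite: AtseriasMuller2020, Lemma 10] -/
theorem rrefCNF_lowerBound_holds : rrefCNF_lowerBound :=
  AtseriasMuller.rrefCNF_lowerBound_holds'

end Literature.Computability.MetaComplexity
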